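import Literature.MathematicalPhysics.QuantumFieldTheory.Balaban1983to89.B6Prop27KLevelV1L0
import HarnessLib
import Literature.MathematicalPhysics.QuantumFieldTheory.Balaban1983to89.B6Geom246MultiLevelBoxL0
import Literature.MathematicalPhysics.QuantumFieldTheory.Balaban1983to89.B6GlobalChartV1L0
import Literature.MathematicalPhysics.QuantumFieldTheory.Balaban1983to89.B6Ineq2142KLevelV1L0
import Literature.MathematicalPhysics.QuantumFieldTheory.Balaban1983to89.B6MultiLevelTorusOperatorL0
import Literature.MathematicalPhysics.QuantumFieldTheory.Balaban1983to89.B6QGQTestBumpsKLevelV1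

/-!
# `Balaban1983to89.B6QGQTestBumpsKLevelV1L0` — LEVEL-0 TWIN (programme G-F3′-L0, director-ym LINE №27 / UV3-NODE §24.5; plan `lit-balaban-r03/G-F3L0-PLAN.md`) of `B6QGQTestBumpsKLevelV1`:
the same declarations, SAME NAMES AND STATEMENTS, for nested families WITH print's region `Λ₀ = T ∖ Ω₁` ADMITTED (structures
`B6MultiLevelBoxOperatorL0.Domains` / `B6MultiLevelTorusOperatorL0.TDomains`: levels `0, …, k`, the level-`0` block a single site, `Q′₀ = id`,
finite weight `a₀` — print p.225 (2.14) «Σ_{j=0}^k … (Q′₀λ)(x) = λ(x), x ∈ Λ₀», p.229 «taking a sequence (2.1) … smallest possible domains B^j(Λ_j),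
and considering the operator Δ_a defined by (2.19), (2.20) for this sequence»).  Every `D`-free object is the lineage's, consumed BY NAME; no existing
module is touched; no fact is minted.  JOINT J7 IN THIS FILE (index bonds of level `0`, i.e. bonds of `Λ₀`, exist once `Ω₁ ≠ T`): a level-0
index bond `i = (0, b)` gets the EFFECTIVE tent radius `r̂ = max(r, 1) = 1` (`erad`; `L^0 = 1`, `r = ⌊1/5⌋ = 0`), so that `φ_i` is the indicator
of the bond `b` itself (`Q₀ = id`), with mass `m_i = c_Q(0)·(1 − 0)·1·1 = 1` — the lineage formulas `mass_eq`, `partner_eq/le`, `pair_src/tgt`,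
`level_window`, the counts and the energy bounds hold VERBATIM; `one_le_rad`/`erad_eq_rad` carry the level hypothesis `1 ≤ j(i)` explicitly,
`tsumL_pos` and `card_fine_seen_le` lose their guards, and the binders `(hk1 : 1 ≤ k)` (which only fed the lineage's `one_le_lvl`) are dropped
throughout (callers drop the argument).  Ported by p34 g114 (r03 g36 delegation 2026-08-27T20:36:03Z).  Unit `lit-balaban-r03` (B6 fold owner, r03 gen 36); referee ref-4.  THE TWIN'S DOCUMENTATION FOLLOWS
VERBATIM (its «levels 1 … k» / «Ω₁ = X» sentences describe the twin; here `j` runs from `0` and `Ω₁` may be a proper subset).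

# `Balaban1983to89.B6QGQTestBumpsKLevelV1` — T. Bałaban, *Propagators and renormalization transformations for lattice gauge theories. II*,
Comm. Math. Phys. **96** (1984) 223–250 [Balaban1984PropagatorsII], **the test fields for the lower bound (2.147) on `QGQ*` AT
k LEVELS** (ROUTE W file W1, part 1 of 2; part 2 = `B6QGQCoerciveKLevelV1`; B6-CLOSURE §5 item 17, design v2).

HONEST FRAMING (programme rule): statement-level skeleton of published theorems with citation tags; proofs where landed; nothing here
is a claim about the Yang–Mills mass gap.  The print's argument for (2.147) is
«The operator C is an inverse to the operator of the quadratic form (2.120), hence it is bounded from below by an inverse of an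
upper bound of this form. Taking into account that ‖B₁‖² is bounded from below by const‖B‖², we get ⟨B,(QGQ*)B⟩ ≥ γ₀‖B‖² (2.147)
with a positive constant γ₀ depending on d and L only» (p. 248); this file and its sequel are OUR explicit
realisation of that lower bound on ROUTE V's torus model (`B6GlobalChartV1L0.domT`) — the same mechanism («bounded from below by an inverse
of an upper bound of this form» = the variational principle of §1) with integer tent test fields on the carrier blocks supplying the upper
bound of the form; all constants explicit and k-uniform (ours depend on `d`, `L` and the band constant `b₁` of (2.16), the weights being
assumed in the band only).

## WHAT THIS FILE CERTIFIES (kernel-checked, sorry-free, standard axioms)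

* §1 **`inner_GE_ge_of_test`** (`⟪φ,u⟫²/⟪φ,Δ_aφ⟫ ≤ ⟪u,Gu⟫` for `G = Δ_a⁻¹`, any `Domains` datum) and **`qgq_coercive_of_test_map`** (a linear
  test map `Φ` with `⟪QΦv, v⟫ ≥ a·S(v)` and `⟪Φv, Δ_aΦv⟫ ≤ b·S(v)` gives `(a²/b)·S(v) ≤ ⟪Q*v, GQ*v⟫`).
* §2–§3 block coordinates `loc` (`sum_block_prod`: a product density sums to the product of the coordinate sums), runs across a block, and
  **the exact averaging weights of the multi-scale `Q` on a carrier block** (`qwt_src`: `c_Q(j)·(loc_μ + 1)` on `B^j(b₋)`, `qwt_tgt`: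
  `c_Q(j)·(L^j − 1 − loc_μ)` on `B^j(b₊)`, zero elsewhere / other directions).
* §4 the tent bumps `φ_i` on the base block of the index bond `i` (longitudinal `τ(u) = max(0, r − |u − ctr|)`, `r = ⌊L^j/5⌋`, centre fitted to
  the case `b₋ ∈ Ω_j` / `b₋ ∉ Ω_j`; transverse `τ_⊥(c) = min(c+1, L^j − c)`), and the pairings `(Qφ_i)_{i′}` in closed form (`pair_src`,
  `pair_tgt`, `pair_le`, vanishing for other directions / disjoint blocks).
* §5 the rows: `mass_eq` (`m_i = c_Q(L^j − r)·Στ·(Στ_⊥)^d > 0`), `partner_eq/le` (a same-level partner row is exactly `r/(L^j − r) ≤ ¼` of the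
  mass), `level_window` (nonzero rows have level `j` or `j+1`), keys (`ext_of_key`, `card_key_le_one`), `sum_qwt_level_le`, and the coarse
  counts `card_coarse_rows_le ≤ 2`, `card_fine_seen_le ≤ 2L^D`.
* §6a–§6c `energy_le` (`⟪A, Δ_aA⟫ ≤ c_f²(D+2)·Σ_fΣ_ν(Δ_νA)(f)² + Σ_i w_i(QA)_i²`), locality `grad_sq_le` (`4D`), `qrow_sq_le` (`4D·L^D`),
  and the `Q`-energy of one bump `qenergy_bump_le`.

## HONEST SCOPE

Everything is bookkeeping for the sequel's `qgq_coercive_kLevel`; the standing hypotheses appear lemma by lemma (`1 ≤ k`, `4 ≤ ℓ`,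
`2 ≤ R·M̂`, torus periods `≥ 2`).  No statement of the print is asserted here beyond the cited dictionary items.
-/

namespace Literature.MathematicalPhysics.QuantumFieldTheory.Balaban1983to89.B6QGQTestBumpsKLevelV1L0

open scoped InnerProductSpace
open LatticeFieldCalculus
open B6SectADomainsV1 (Domains)
open B6SectAOperatorsV1 (QE QsE BondIdx BondIdxSpace inner_QsE_left)
open B6SectAVectorModelV1 (GE deltaAE inner_GE_left deltaAE_GE inner_deltaAE_left inner_deltaAE_self_nonneg
  eq_zero_of_inner_deltaAE_self_eq_zero inner_GE_pos)
open BalabanImbrieJaffe1984to88.BIJ85AxialPropagator411 (BondSpace)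
open Literature.MathematicalPhysics.QuantumFieldTheory.Balaban1983to89.B6QGQTestBumpsKLevelV1 (inner_GE_self_nonneg inner_GE_ge_of_test qgq_coercive_of_test_map loc loc_lt val_eq_of_mem ofLoc ofLoc_val ofLoc_mem loc_ofLoc ofLoc_loc ofLoc_injective sum_block_eq_sum_loc sum_block_prod runSite_mem_of_loc val_shift_self' eq_of_loc_eq shift_mem_next runSite_mem_next shift_ne_self runSite_eq_unique reach_src_iff reach_tgt_iff sum_fin_ite_le sum_fin_ite_gt sum_fin_ite_eq sum_range_ite_runSite pairCount_src pairCount_tgt sum_moment_tent sum_affine_tent tauT one_le_tauT Tsum iterBlock_injective Tsum_pos bdiff curl_sq_le norm_dcE_sq_le norm_dsE_sq_le energy_le sq_sum_le_card_support_mul tgt_eq_iff_src_eq cQ_mul_pow)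

noncomputable section

/-! ## §3b  The exact averaging weights `q_i` on the source and target blocks -/

section Weights

open B5Eq118OneStroke (iterBlock iterBlockOf mem_iterBlock mem_iterBlock_iff)
open B6MultiLevelBoxOperator (N0)
open B6MultiLevelTorusOperatorL0 (TDomains)
open B6GlobalChartV1 (PV)
open B6GlobalChartV1L0 (domT)
open B6Ineq2142KLevelV1 (cQ iterBlockOf_runSite_mem)
open B6Ineq2142KLevelV1L0 (lvl lvl_le_mK qwt qwt_eq_sum exists_of_qwt_ne_zero)

variable {d ℓ m K : ℕ} {hd : 1 ≤ d + 1} {hL : Odd (ℓ + 1) ∧ 1 < ℓ + 1}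
variable {Mh k R : ℕ} {P' : Fin (d + 1) → ℕ}
variable (hN : ∀ μ, N0 ℓ Mh k P' μ = (PV d ℓ m K hd hL).sitesPerDir 0) (D : TDomains d ℓ Mh k P' R) (hk : k ≤ m + K)

/-- **`q_i` ON THE SOURCE BLOCK**: `q_i(⟨z, μ_i⟩) = c_Q·(loc_μ z + 1)` for `z ∈ B^j(b₋)` — the increasing tent toward the face shared with `B^j(b₊)`.
[cite: Balaban1984PropagatorsI, (1.18) p.20; Balaban1984PropagatorsII, (2.20) p.226] -/
theorem qwt_src (i : BondIdx (B6GlobalChartV1L0.domT hN D hk)) (hper : 2 ≤ (PV d ℓ m K hd hL).sitesPerDir (lvl hN D hk i)) {z : Site (PV d ℓ m K hd hL) 0}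
    (hz : z ∈ iterBlock (lvl hN D hk i) i.1.2.src) :
    qwt hN D hk i ⟨z, i.1.2.dir⟩ = cQ (d := d) (ℓ := ℓ) (lvl hN D hk i) * ((loc (lvl hN D hk i) z i.1.2.dir : ℝ) + 1) := by
  classical
  rw [qwt_eq_sum, ← pairCount_src (lvl_le_mK hN D hk i) hper hz i.1.2.dir]
  congr 1
  refine Finset.sum_congr rfl fun x _ => Finset.sum_congr rfl fun t _ => ?_
  exact if_congr (by simp [runBond, PBond.mk.injEq]) rfl rfl

/-- **`q_i` ON THE TARGET BLOCK**: `q_i(⟨z, μ_i⟩) = c_Q·(L^j − 1 − loc_μ z)` for `z ∈ B^j(b₊)` — the decreasing tent.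
[cite: Balaban1984PropagatorsI, (1.18) p.20; Balaban1984PropagatorsII, (2.20) p.226] -/
theorem qwt_tgt (i : BondIdx (B6GlobalChartV1L0.domT hN D hk)) (hper : 2 ≤ (PV d ℓ m K hd hL).sitesPerDir (lvl hN D hk i)) {z : Site (PV d ℓ m K hd hL) 0}
    (hz : z ∈ iterBlock (lvl hN D hk i) i.1.2.tgt) :
    qwt hN D hk i ⟨z, i.1.2.dir⟩ = cQ (d := d) (ℓ := ℓ) (lvl hN D hk i) * ((((ℓ + 1) ^ (lvl hN D hk i) - 1 - loc (lvl hN D hk i) z i.1.2.dir : ℕ) : ℝ)) := by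
  classical
  have hz' : z ∈ iterBlock (lvl hN D hk i) (i.1.2.src.shift i.1.2.dir) := hz
  rw [qwt_eq_sum, ← pairCount_tgt (lvl_le_mK hN D hk i) hper i.1.2.dir hz']
  congr 1
  refine Finset.sum_congr rfl fun x _ => Finset.sum_congr rfl fun t _ => ?_
  exact if_congr (by simp [runBond, PBond.mk.injEq]) rfl rfl

/-- **`q_i` VANISHES ON BONDS OF OTHER DIRECTIONS.** [cite: Balaban1984PropagatorsI, (1.18) p.20] -/
theorem qwt_eq_zero_of_dir_ne (i : BondIdx (B6GlobalChartV1L0.domT hN D hk)) {f : PBond (PV d ℓ m K hd hL) 0} (hf : f.dir ≠ i.1.2.dir) :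
    qwt hN D hk i f = 0 := by
  by_contra h
  obtain ⟨x, -, t, -, hxt⟩ := exists_of_qwt_ne_zero hN D hk i h
  exact hf (by rw [← hxt]; rfl)

/-- **`q_i` VANISHES OFF THE DOUBLE BLOCK `B^j(b₋) ∪ B^j(b₊)`.** [cite: Balaban1984PropagatorsI, (1.18) p.20] -/
theorem qwt_eq_zero_of_not_mem (i : BondIdx (B6GlobalChartV1L0.domT hN D hk)) {f : PBond (PV d ℓ m K hd hL) 0}
    (h1 : f.src ∉ iterBlock (lvl hN D hk i) i.1.2.src) (h2 : f.src ∉ iterBlock (lvl hN D hk i) i.1.2.tgt) : qwt hN D hk i f = 0 := by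
  by_contra h
  obtain ⟨x, hx, t, ht, hxt⟩ := exists_of_qwt_ne_zero hN D hk i h
  rw [mem_iterBlock] at hx
  have hsrc : f.src = runSite x i.1.2.dir t := by rw [← hxt]; rfl
  rcases iterBlockOf_runSite_mem (lvl_le_mK hN D hk i) x i.1.2.dir ht.le with h' | h'
  · exact h1 (by rw [mem_iterBlock, hsrc, h', hx])
  · exact h2 (by rw [mem_iterBlock, hsrc, h', hx]; rfl)

end Weights

/-! ## §4  The test bumps `φ_i` and their exact pairings with the averaging weights -/

section Bumps

open B5Eq118OneStroke (iterBlock iterBlockOf mem_iterBlock mem_iterBlock_iff)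
open B6MultiLevelBoxOperator (N0)
open B6MultiLevelTorusOperatorL0 (TDomains)
open B6GlobalChartV1 (PV)
open B6GlobalChartV1L0 (domT)
open B6SectAOperatorsV1 (inner_eq_sum)
open B6Ineq2142KLevelV1 (cQ cQ_pos)
open B6Ineq2142KLevelV1L0 (lvl lvl_le_mK base base_mem ends_eq qwt qwt_eq_sum QsE_single_apply)

variable {d ℓ m K : ℕ} {hd : 1 ≤ d + 1} {hL : Odd (ℓ + 1) ∧ 1 < ℓ + 1}
variable {Mh k R : ℕ} {P' : Fin (d + 1) → ℕ}
variable (hN : ∀ μ, N0 ℓ Mh k P' μ = (PV d ℓ m K hd hL).sitesPerDir 0) (D : TDomains d ℓ Mh k P' R) (hk : k ≤ m + K)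

/-- the radius `r = ⌊L^j/5⌋` of the longitudinal tent. [cite: Balaban1984PropagatorsII, (2.147) p.248, bookkeeping ours] -/
def rad (i : BondIdx (domT hN D hk)) : ℕ := (ℓ + 1) ^ (lvl hN D hk i) / 5

/-- `1 ≤ r` for `L ≥ 5`, `j ≥ 1` (LEVEL-0 TWIN, joint J7: the level hypothesis `1 ≤ j(i)` is explicit — a level-0 index bond has `r = 0`).
[cite: Balaban1984PropagatorsII, (2.147) p.248, bookkeeping] -/
theorem one_le_rad (hℓ : 4 ≤ ℓ) (i : BondIdx (domT hN D hk)) (hj : 1 ≤ lvl hN D hk i) : 1 ≤ rad hN D hk i := by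
  unfold rad
  have h5 : 5 ≤ (ℓ + 1) ^ (lvl hN D hk i) :=
    le_trans (by rw [pow_one]; omega : 5 ≤ (ℓ + 1) ^ 1) (Nat.pow_le_pow_right (by omega) hj)
  exact (Nat.le_div_iff_mul_le (by norm_num)).2 (by omega)

/-- `5r ≤ L^j`. [cite: Balaban1984PropagatorsII, (2.147) p.248, bookkeeping] -/
theorem five_mul_rad_le (i : BondIdx (domT hN D hk)) : 5 * rad hN D hk i ≤ (ℓ + 1) ^ (lvl hN D hk i) := by
  unfold rad; rw [mul_comm]; exact Nat.div_mul_le_self _ _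

/-- LEVEL-0 TWIN (joint J7): **the EFFECTIVE tent radius `r̂ = max(r, 1)`** — equal to `r` at levels `j ≥ 1` (`L ≥ 5`, `erad_eq_rad`), and `1`
for a level-0 index bond (`L^0 = 1`, `r = 0`), where the tent below degenerates to the indicator of the single base site, i.e. `φ_i` is the
indicator of the bond `i` itself (`Q₀ = id`: print (2.20) p.226 «(Q₀A)(b) = A(b)», (2.14) p.225 «(Q′₀λ)(x) = λ(x), x ∈ Λ₀»).
[cite: Balaban1984PropagatorsII, (2.20) p.226, (2.147) p.248, bookkeeping ours] -/
def erad (i : BondIdx (domT hN D hk)) : ℕ := max (rad hN D hk i) 1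

/-- `1 ≤ r̂`. [cite: Balaban1984PropagatorsII, (2.147) p.248, bookkeeping] -/
theorem one_le_erad (i : BondIdx (domT hN D hk)) : 1 ≤ erad hN D hk i := le_max_right _ _

/-- `r ≤ r̂`. [cite: Balaban1984PropagatorsII, (2.147) p.248, bookkeeping] -/
theorem rad_le_erad (i : BondIdx (domT hN D hk)) : rad hN D hk i ≤ erad hN D hk i := le_max_left _ _

/-- `r̂ = r` at levels `j ≥ 1` (`L ≥ 5`). [cite: Balaban1984PropagatorsII, (2.147) p.248, bookkeeping] -/
theorem erad_eq_rad (hℓ : 4 ≤ ℓ) (i : BondIdx (domT hN D hk)) (hj : 1 ≤ lvl hN D hk i) : erad hN D hk i = rad hN D hk i :=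
  max_eq_left (one_le_rad hN D hk hℓ i hj)

/-- a level-0 index bond has `r = 0`. [cite: Balaban1984PropagatorsII, (2.20) p.226, bookkeeping] -/
theorem rad_eq_zero_of_lvl (i : BondIdx (domT hN D hk)) (h : lvl hN D hk i = 0) : rad hN D hk i = 0 := by
  unfold rad; simp [h]

/-- a level-0 index bond has `r̂ = 1`. [cite: Balaban1984PropagatorsII, (2.20) p.226, bookkeeping] -/
theorem erad_eq_one_of_lvl (i : BondIdx (domT hN D hk)) (h : lvl hN D hk i = 0) : erad hN D hk i = 1 := by
  unfold erad; rw [rad_eq_zero_of_lvl hN D hk i h]; rfl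

/-- in case B (`b₋ ∉ Ω_j^{(j)}`) the level is positive, since `Ω₀ = T` (LEVEL-0 TWIN, joint J7: replaces the lineage's `one_le_lvl`).
[cite: Balaban1984PropagatorsII, (2.1)/(2.3) p.224] -/
theorem one_le_lvl_of_not_mem (i : BondIdx (domT hN D hk)) (hB : i.1.2.src ∉ (domT hN D hk).Om (lvl hN D hk i)) :
    1 ≤ lvl hN D hk i := by
  obtain ⟨⟨⟨j, hj⟩, b⟩, hb⟩ := i
  by_contra h
  have hj0 : j = 0 := by simp only [lvl, not_le, Nat.lt_one_iff] at h; exact h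
  subst hj0
  exact hB (by rw [(domT hN D hk).Om_zero]; exact Finset.mem_univ _)

/-- the centre of the longitudinal tent: `L^j − 1 − r` next to the face shared with `B(b₊)` when the base block is the source block
(case A), `r − 1` next to the face shared with `B(b₋)` when it is the target block (case B). [cite: Balaban1984PropagatorsII, (2.147) p.248, bookkeeping ours] -/
def ctr (i : BondIdx (domT hN D hk)) : ℕ :=
  if i.1.2.src ∈ (domT hN D hk).Om (lvl hN D hk i) then (ℓ + 1) ^ (lvl hN D hk i) - 1 - rad hN D hk i else rad hN D hk i - 1

/-- the longitudinal tent `τ(u) = (r̂ − |u − c|)⁺`, `r̂ = max(r, 1)` (LEVEL-0 TWIN, joint J7: `r̂ = r` at levels `≥ 1`; at level `0` the tent is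
the indicator of the single base site). [cite: Balaban1984PropagatorsII, (2.147) p.248, bookkeeping ours] -/
def tauL (i : BondIdx (domT hN D hk)) (u : ℕ) : ℝ := max 0 ((erad hN D hk i : ℝ) - |(u : ℝ) - ctr hN D hk i|)

/-- `τ ≥ 0`. [cite: Balaban1984PropagatorsII, (2.147) p.248, bookkeeping] -/
theorem tauL_nonneg (i : BondIdx (domT hN D hk)) (u : ℕ) : 0 ≤ tauL hN D hk i u := le_max_left _ _

/-- **THE BUMP `φ_i`**: supported on the `μ_i`-bonds issuing from the base block `B^j(base i)`, product of the longitudinal and transverse tents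
in block-local coordinates. [cite: Balaban1984PropagatorsII, (2.147) p.248 (test functions for the lower bound), bookkeeping ours] -/
def bumpFn (i : BondIdx (domT hN D hk)) : PBond (PV d ℓ m K hd hL) 0 → ℝ := fun f =>
  if f.dir = i.1.2.dir ∧ f.src ∈ iterBlock (lvl hN D hk i) (base hN D hk i) then
    tauL hN D hk i (loc (lvl hN D hk i) f.src i.1.2.dir) *
      ∏ ν ∈ Finset.univ.erase i.1.2.dir, tauT (ℓ := ℓ) (lvl hN D hk i) (loc (lvl hN D hk i) f.src ν)
  else 0

/-- `φ_i` as an element of `L²(bonds)`. [cite: Balaban1984PropagatorsII, (2.147) p.248] -/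
def bump (i : BondIdx (domT hN D hk)) : BondSpace (PV d ℓ m K hd hL) := WithLp.toLp 2 (bumpFn hN D hk i)

/-- `φ_i ≥ 0`. [cite: Balaban1984PropagatorsII, (2.147) p.248, bookkeeping] -/
theorem bumpFn_nonneg (i : BondIdx (domT hN D hk)) (f : PBond (PV d ℓ m K hd hL) 0) : 0 ≤ bumpFn hN D hk i f := by
  unfold bumpFn
  split_ifs with h
  · refine mul_nonneg (tauL_nonneg hN D hk i _) (Finset.prod_nonneg fun ν _ => ?_)
    exact zero_le_one.trans (one_le_tauT (loc_lt _ _ _))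
  · exact le_rfl

/-- **THE PAIRING FORMULA**: `(Qφ)_{i′} = Σ_f q_{i′}(f)·φ(f)`. [cite: Balaban1984PropagatorsII, (2.20) p.226; Balaban1984PropagatorsI, (1.18) p.20] -/
theorem QE_apply_eq_sum_qwt (i' : BondIdx (B6GlobalChartV1L0.domT hN D hk)) (v : BondSpace (PV d ℓ m K hd hL)) :
    QE (domT hN D hk) v i' = ∑ f, qwt hN D hk i' f * v f := by
  have h : QE (domT hN D hk) v i' = ⟪EuclideanSpace.single i' (1 : ℝ), QE (domT hN D hk) v⟫_ℝ := by
    rw [EuclideanSpace.inner_single_left]; simp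
  rw [h, ← inner_QsE_left, inner_eq_sum]
  exact Finset.sum_congr rfl fun f _ => by rw [QsE_single_apply]

end Bumps

/-! ## §4b  The exact pairings: mass, partner, coarse bound, vanishing -/

section Pairings

open B5Eq118OneStroke (iterBlock iterBlockOf mem_iterBlock mem_iterBlock_iff)
open B6MultiLevelBoxOperator (N0)
open B6MultiLevelTorusOperatorL0 (TDomains)
open B6GlobalChartV1 (PV)
open B6GlobalChartV1L0 (domT)
open B6Ineq2142KLevelV1 (cQ cQ_pos)
open B6Ineq2142KLevelV1L0 (lvl lvl_le_mK base qwt qwt_nonneg qwt_le)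

variable {d ℓ m K : ℕ} {hd : 1 ≤ d + 1} {hL : Odd (ℓ + 1) ∧ 1 < ℓ + 1}
variable {Mh k R : ℕ} {P' : Fin (d + 1) → ℕ}
variable (hN : ∀ μ, N0 ℓ Mh k P' μ = (PV d ℓ m K hd hL).sitesPerDir 0) (D : TDomains d ℓ Mh k P' R) (hk : k ≤ m + K)

/-- the longitudinal tent mass `Σ_u τ(u)`. [cite: Balaban1984PropagatorsII, (2.147) p.248, bookkeeping] -/
def tsumL (i : BondIdx (domT hN D hk)) : ℝ := ∑ t : Fin ((ℓ + 1) ^ (lvl hN D hk i)), tauL hN D hk i t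

/-- **A PAIRING AGAINST A WEIGHT SUPPORTED ON THE BASE BLOCK**: if `q_{i′}(⟨z, μ_i⟩) = c·a(loc_μ z)` on `B^j(base i)` then
`(Qφ_i)_{i′} = c·(Σ_u a(u)τ(u))·(Στ_⊥)^d` (Fubini on the block). [cite: Balaban1984PropagatorsI, (1.18) p.20; Balaban1984PropagatorsII, (2.147) p.248, bookkeeping] -/
theorem pair_eq_of_weight (i i' : BondIdx (domT hN D hk)) {c : ℝ} {a : ℕ → ℝ}
    (hq : ∀ z ∈ iterBlock (lvl hN D hk i) (base hN D hk i), qwt hN D hk i' ⟨z, i.1.2.dir⟩ = c * a (loc (lvl hN D hk i) z i.1.2.dir)) :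
    QE (domT hN D hk) (bump hN D hk i) i' =
      c * (∑ t : Fin ((ℓ + 1) ^ (lvl hN D hk i)), a t * tauL hN D hk i t) * Tsum (ℓ := ℓ) (lvl hN D hk i) ^ d := by
  classical
  set j := lvl hN D hk i
  set μ := i.1.2.dir
  rw [QE_apply_eq_sum_qwt, B10StarCount.sum_pbond]
  -- collapse the direction sum and restrict to the base block
  have h1 : ∀ z : Site (PV d ℓ m K hd hL) 0, (∑ ν : Fin (d + 1), qwt hN D hk i' ⟨z, ν⟩ * bump hN D hk i ⟨z, ν⟩) =
      if z ∈ iterBlock j (base hN D hk i) then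
        c * (a (loc j z μ) * tauL hN D hk i (loc j z μ)) * ∏ ν ∈ Finset.univ.erase μ, tauT (ℓ := ℓ) j (loc j z ν) else 0 := by
    intro z
    have hb : ∀ ν, bump hN D hk i ⟨z, ν⟩ = if ν = μ ∧ z ∈ iterBlock j (base hN D hk i) then
        tauL hN D hk i (loc j z μ) * ∏ ν ∈ Finset.univ.erase μ, tauT (ℓ := ℓ) j (loc j z ν) else 0 := fun ν => rfl
    simp_rw [hb]
    by_cases hz : z ∈ iterBlock j (base hN D hk i)
    · rw [if_pos hz]
      rw [Finset.sum_eq_single μ (fun ν _ hν => by rw [if_neg (fun h => hν h.1), mul_zero]) (fun h => absurd (Finset.mem_univ μ) h),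
        if_pos ⟨rfl, hz⟩, hq z hz]
      ring
    · rw [if_neg hz]
      exact Finset.sum_eq_zero fun ν _ => by rw [if_neg (fun h => hz h.2), mul_zero]
  rw [Finset.sum_congr rfl fun z _ => h1 z, ← Finset.sum_filter, Finset.filter_mem_eq_inter, Finset.univ_inter]
  -- Fubini
  set g : Fin (d + 1) → ℕ → ℝ := fun ν u => if ν = μ then c * (a u * tauL hN D hk i u) else tauT (ℓ := ℓ) j u with hg
  have h2 : ∀ z ∈ iterBlock j (base hN D hk i),
      c * (a (loc j z μ) * tauL hN D hk i (loc j z μ)) * ∏ ν ∈ Finset.univ.erase μ, tauT (ℓ := ℓ) j (loc j z ν) = ∏ ν, g ν (loc j z ν) := by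
    intro z _
    rw [← Finset.mul_prod_erase Finset.univ (fun ν => g ν (loc j z ν)) (Finset.mem_univ μ)]
    simp only [hg, if_true]
    congr 1
    exact Finset.prod_congr rfl fun ν hν => by rw [if_neg (Finset.ne_of_mem_erase hν)]
  rw [Finset.sum_congr rfl h2, sum_block_prod (lvl_le_mK hN D hk i),
    ← Finset.mul_prod_erase Finset.univ (fun ν => ∑ t : Fin ((ℓ + 1) ^ j), g ν t) (Finset.mem_univ μ)]
  simp only [hg, if_true]
  rw [← Finset.mul_sum, Finset.prod_congr rfl fun ν hν => by rw [show (∑ t : Fin ((ℓ + 1) ^ j), if ν = μ then c * (a t * tauL hN D hk i t)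
      else tauT (ℓ := ℓ) j t) = Tsum (ℓ := ℓ) j from Finset.sum_congr rfl fun t _ => by rw [if_neg (Finset.ne_of_mem_erase hν)]],
    Finset.prod_const, Finset.card_erase_of_mem (Finset.mem_univ μ), Finset.card_univ, Fintype.card_fin]
  rfl

/-- the tents fit inside the block: `r ≤ ctr + 1` and `ctr + r ≤ L^j`. [cite: Balaban1984PropagatorsII, (2.147) p.248, bookkeeping] -/
theorem ctr_fit (i : BondIdx (domT hN D hk)) :
    rad hN D hk i ≤ ctr hN D hk i + 1 ∧ ctr hN D hk i + rad hN D hk i ≤ (ℓ + 1) ^ (lvl hN D hk i) := by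
  have h5 := five_mul_rad_le hN D hk i
  unfold ctr
  split_ifs <;> omega

/-- the EFFECTIVE tents fit inside the block: `r̂ ≤ ctr + 1` and `ctr + r̂ ≤ L^j` (LEVEL-0 TWIN, joint J7).
[cite: Balaban1984PropagatorsII, (2.147) p.248, bookkeeping] -/
theorem ctr_fit' (i : BondIdx (domT hN D hk)) :
    erad hN D hk i ≤ ctr hN D hk i + 1 ∧ ctr hN D hk i + erad hN D hk i ≤ (ℓ + 1) ^ (lvl hN D hk i) := by
  have h5 := five_mul_rad_le hN D hk i
  have hS : 1 ≤ (ℓ + 1) ^ (lvl hN D hk i) := Nat.one_le_pow _ _ (by omega)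
  unfold ctr erad
  split_ifs <;> omega

/-- **THE SOURCE-TYPE PAIRING**: if `B^j(src i′) = B^j(base i)` (same level, same direction) then `(Qφ_i)_{i′} = c_Q·(ctr + 1)·Στ·(Στ_⊥)^d`.
[cite: Balaban1984PropagatorsII, (2.147) p.248; Balaban1984PropagatorsI, (1.18) p.20] -/
theorem pair_src (i i' : BondIdx (domT hN D hk)) (hper : 2 ≤ (PV d ℓ m K hd hL).sitesPerDir (lvl hN D hk i'))
    (hj : lvl hN D hk i' = lvl hN D hk i) (hdir : i'.1.2.dir = i.1.2.dir)
    (hblk : iterBlock (lvl hN D hk i') i'.1.2.src = iterBlock (lvl hN D hk i) (base hN D hk i)) :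
    QE (domT hN D hk) (bump hN D hk i) i' =
      cQ (d := d) (ℓ := ℓ) (lvl hN D hk i) * ((ctr hN D hk i : ℝ) + 1) * tsumL hN D hk i * Tsum (ℓ := ℓ) (lvl hN D hk i) ^ d := by
  have hq : ∀ z ∈ iterBlock (lvl hN D hk i) (base hN D hk i), qwt hN D hk i' ⟨z, i.1.2.dir⟩ =
      cQ (d := d) (ℓ := ℓ) (lvl hN D hk i) * (fun u : ℕ => (u : ℝ) + 1) (loc (lvl hN D hk i) z i.1.2.dir) := by
    intro z hz
    rw [← hblk] at hz
    have h := qwt_src hN D hk i' hper hz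
    rw [hdir, hj] at h
    exact h
  rw [pair_eq_of_weight hN D hk i i' (a := fun u : ℕ => (u : ℝ) + 1) hq]
  have hfit := ctr_fit' hN D hk i
  have haff := sum_affine_tent (S := (ℓ + 1) ^ (lvl hN D hk i)) hfit.1 hfit.2 1 1
  simp only [one_mul] at haff
  unfold tsumL tauL
  rw [show (∑ t : Fin ((ℓ + 1) ^ (lvl hN D hk i)), ((t : ℝ) + 1) * max 0 ((erad hN D hk i : ℝ) - |(t : ℝ) - ctr hN D hk i|)) =
      ((ctr hN D hk i : ℝ) + 1) * ∑ t : Fin ((ℓ + 1) ^ (lvl hN D hk i)), max 0 ((erad hN D hk i : ℝ) - |(t : ℝ) - ctr hN D hk i|) by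
    rw [add_comm (ctr hN D hk i : ℝ) 1, ← haff]; exact Finset.sum_congr rfl fun t _ => by ring]
  ring

/-- **THE TARGET-TYPE PAIRING**: if `B^j(tgt i′) = B^j(base i)` (same level, same direction) then `(Qφ_i)_{i′} = c_Q·(L^j − 1 − ctr)·Στ·(Στ_⊥)^d`.
[cite: Balaban1984PropagatorsII, (2.147) p.248; Balaban1984PropagatorsI, (1.18) p.20] -/
theorem pair_tgt (i i' : BondIdx (domT hN D hk)) (hper : 2 ≤ (PV d ℓ m K hd hL).sitesPerDir (lvl hN D hk i'))
    (hj : lvl hN D hk i' = lvl hN D hk i) (hdir : i'.1.2.dir = i.1.2.dir)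
    (hblk : iterBlock (lvl hN D hk i') i'.1.2.tgt = iterBlock (lvl hN D hk i) (base hN D hk i)) :
    QE (domT hN D hk) (bump hN D hk i) i' =
      cQ (d := d) (ℓ := ℓ) (lvl hN D hk i) * ((((ℓ + 1) ^ (lvl hN D hk i) : ℕ) : ℝ) - 1 - ctr hN D hk i) * tsumL hN D hk i *
        Tsum (ℓ := ℓ) (lvl hN D hk i) ^ d := by
  have hq : ∀ z ∈ iterBlock (lvl hN D hk i) (base hN D hk i), qwt hN D hk i' ⟨z, i.1.2.dir⟩ =
      cQ (d := d) (ℓ := ℓ) (lvl hN D hk i) * (fun u : ℕ => (((ℓ + 1) ^ (lvl hN D hk i) : ℕ) : ℝ) - 1 - u) (loc (lvl hN D hk i) z i.1.2.dir) := by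
    intro z hz
    rw [← hblk] at hz
    have h := qwt_tgt hN D hk i' hper hz
    rw [hdir, hj] at h
    rw [h]
    simp only
    have hlt := loc_lt (lvl hN D hk i) z i.1.2.dir
    rw [Nat.cast_sub (by omega), Nat.cast_sub (Nat.one_le_pow _ _ (by omega))]
    push_cast; ring
  rw [pair_eq_of_weight hN D hk i i' (a := fun u : ℕ => (((ℓ + 1) ^ (lvl hN D hk i) : ℕ) : ℝ) - 1 - u) hq]
  have hfit := ctr_fit' hN D hk i
  have haff := sum_affine_tent (S := (ℓ + 1) ^ (lvl hN D hk i)) hfit.1 hfit.2 ((((ℓ + 1) ^ (lvl hN D hk i) : ℕ) : ℝ) - 1) (-1)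
  unfold tsumL tauL
  rw [show (∑ t : Fin ((ℓ + 1) ^ (lvl hN D hk i)), ((((ℓ + 1) ^ (lvl hN D hk i) : ℕ) : ℝ) - 1 - t) *
      max 0 ((erad hN D hk i : ℝ) - |(t : ℝ) - ctr hN D hk i|)) =
      ((((ℓ + 1) ^ (lvl hN D hk i) : ℕ) : ℝ) - 1 - ctr hN D hk i) * ∑ t : Fin ((ℓ + 1) ^ (lvl hN D hk i)), max 0 ((erad hN D hk i : ℝ) - |(t : ℝ) - ctr hN D hk i|) by
    have : ∀ t : Fin ((ℓ + 1) ^ (lvl hN D hk i)), ((((ℓ + 1) ^ (lvl hN D hk i) : ℕ) : ℝ) - 1 - t) =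
        ((((ℓ + 1) ^ (lvl hN D hk i) : ℕ) : ℝ) - 1) + (-1) * t := fun t => by ring
    simp_rw [this]
    rw [haff]; ring]
  ring

/-- **THE COARSE (AND EVERY) PAIRING IS BOUNDED BY THE SUP OF THE WEIGHT TIMES THE BUMP MASS**: `|(Qφ_i)_{i′}| ≤ L^{−j′D}·Στ·(Στ_⊥)^d`.
[cite: Balaban1984PropagatorsII, (2.147) p.248; Balaban1984PropagatorsI, (1.18) p.20] -/
theorem pair_le (i i' : BondIdx (domT hN D hk)) :
    |QE (domT hN D hk) (bump hN D hk i) i'| ≤ ((((ℓ + 1 : ℕ) : ℝ) ^ (d + 1)) ^ (lvl hN D hk i'))⁻¹ * (tsumL hN D hk i * Tsum (ℓ := ℓ) (lvl hN D hk i) ^ d) := by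
  classical
  have hsum : QE (domT hN D hk) (bump hN D hk i) i = 1 * (∑ t : Fin ((ℓ + 1) ^ (lvl hN D hk i)), (fun _ : ℕ => (1 : ℝ)) t * tauL hN D hk i t) *
      Tsum (ℓ := ℓ) (lvl hN D hk i) ^ d → True := fun _ => trivial
  clear hsum
  -- `0 ≤ q ≤ L^{−j′D}` and `φ ≥ 0`
  rw [QE_apply_eq_sum_qwt]
  have hnn : ∀ f, 0 ≤ qwt hN D hk i' f * bump hN D hk i f := fun f => mul_nonneg (qwt_nonneg hN D hk i' f) (bumpFn_nonneg hN D hk i f)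
  rw [abs_of_nonneg (Finset.sum_nonneg fun f _ => hnn f)]
  calc ∑ f, qwt hN D hk i' f * bump hN D hk i f ≤ ∑ f, ((((ℓ + 1 : ℕ) : ℝ) ^ (d + 1)) ^ (lvl hN D hk i'))⁻¹ * bump hN D hk i f :=
        Finset.sum_le_sum fun f _ => mul_le_mul_of_nonneg_right (qwt_le hN D hk i' f) (bumpFn_nonneg hN D hk i f)
    _ = ((((ℓ + 1 : ℕ) : ℝ) ^ (d + 1)) ^ (lvl hN D hk i'))⁻¹ * ∑ f, bump hN D hk i f := by rw [Finset.mul_sum]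
    _ = _ := by rw [sum_bump]
  where
  /-- the total mass of the bump: `Σ_f φ_i(f) = Στ·(Στ_⊥)^d`. [cite: Balaban1984PropagatorsII, (2.147) p.248, bookkeeping] -/
  sum_bump : ∑ f, bump hN D hk i f = tsumL hN D hk i * Tsum (ℓ := ℓ) (lvl hN D hk i) ^ d := by
    classical
    -- the pairing formula with the constant weight `1`: reuse `pair_eq_of_weight` with a fictitious weight is not available, so compute directly
    set j := lvl hN D hk i
    set μ := i.1.2.dir
    rw [B10StarCount.sum_pbond]
    have h1 : ∀ z : Site (PV d ℓ m K hd hL) 0, (∑ ν : Fin (d + 1), bump hN D hk i ⟨z, ν⟩) =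
        if z ∈ iterBlock j (base hN D hk i) then tauL hN D hk i (loc j z μ) * ∏ ν ∈ Finset.univ.erase μ, tauT (ℓ := ℓ) j (loc j z ν) else 0 := by
      intro z
      have hb : ∀ ν, bump hN D hk i ⟨z, ν⟩ = if ν = μ ∧ z ∈ iterBlock j (base hN D hk i) then
          tauL hN D hk i (loc j z μ) * ∏ ν ∈ Finset.univ.erase μ, tauT (ℓ := ℓ) j (loc j z ν) else 0 := fun ν => rfl
      simp_rw [hb]
      by_cases hz : z ∈ iterBlock j (base hN D hk i)
      · rw [if_pos hz, Finset.sum_eq_single μ (fun ν _ hν => by rw [if_neg (fun h => hν h.1)]) (fun h => absurd (Finset.mem_univ μ) h),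
          if_pos ⟨rfl, hz⟩]
      · rw [if_neg hz]; exact Finset.sum_eq_zero fun ν _ => by rw [if_neg (fun h => hz h.2)]
    rw [Finset.sum_congr rfl fun z _ => h1 z, ← Finset.sum_filter, Finset.filter_mem_eq_inter, Finset.univ_inter]
    set g : Fin (d + 1) → ℕ → ℝ := fun ν u => if ν = μ then tauL hN D hk i u else tauT (ℓ := ℓ) j u with hg
    have h2 : ∀ z ∈ iterBlock j (base hN D hk i),
        tauL hN D hk i (loc j z μ) * ∏ ν ∈ Finset.univ.erase μ, tauT (ℓ := ℓ) j (loc j z ν) = ∏ ν, g ν (loc j z ν) := by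
      intro z _
      rw [← Finset.mul_prod_erase Finset.univ (fun ν => g ν (loc j z ν)) (Finset.mem_univ μ)]
      simp only [hg, if_true]
      congr 1
      exact Finset.prod_congr rfl fun ν hν => by rw [if_neg (Finset.ne_of_mem_erase hν)]
    rw [Finset.sum_congr rfl h2, sum_block_prod (lvl_le_mK hN D hk i),
      ← Finset.mul_prod_erase Finset.univ (fun ν => ∑ t : Fin ((ℓ + 1) ^ j), g ν t) (Finset.mem_univ μ)]
    simp only [hg, if_true]
    rw [Finset.prod_congr rfl fun ν hν => by rw [show (∑ t : Fin ((ℓ + 1) ^ j), if ν = μ then tauL hN D hk i t else tauT (ℓ := ℓ) j t) =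
        Tsum (ℓ := ℓ) j from Finset.sum_congr rfl fun t _ => by rw [if_neg (Finset.ne_of_mem_erase hν)]],
      Finset.prod_const, Finset.card_erase_of_mem (Finset.mem_univ μ), Finset.card_univ, Fintype.card_fin]
    rfl

/-- **VANISHING FOR OTHER DIRECTIONS.** [cite: Balaban1984PropagatorsI, (1.18) p.20] -/
theorem pair_eq_zero_of_dir_ne (i i' : BondIdx (domT hN D hk)) (hdir : i'.1.2.dir ≠ i.1.2.dir) :
    QE (domT hN D hk) (bump hN D hk i) i' = 0 := by
  rw [QE_apply_eq_sum_qwt]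
  refine Finset.sum_eq_zero fun f _ => ?_
  by_cases hf : f.dir = i.1.2.dir
  · rw [qwt_eq_zero_of_dir_ne hN D hk i' (by rw [hf]; exact fun h => hdir h.symm), zero_mul]
  · have : bump hN D hk i f = 0 := by
      show bumpFn hN D hk i f = 0
      unfold bumpFn; rw [if_neg (fun h => hf h.1)]
    rw [this, mul_zero]

/-- **VANISHING WHEN THE DOUBLE BLOCK OF `i′` MISSES THE BASE BLOCK OF `i`.** [cite: Balaban1984PropagatorsI, (1.18) p.20] -/
theorem pair_eq_zero_of_disjoint (i i' : BondIdx (domT hN D hk))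
    (h1 : Disjoint (iterBlock (lvl hN D hk i') i'.1.2.src) (iterBlock (lvl hN D hk i) (base hN D hk i)))
    (h2 : Disjoint (iterBlock (lvl hN D hk i') i'.1.2.tgt) (iterBlock (lvl hN D hk i) (base hN D hk i))) :
    QE (domT hN D hk) (bump hN D hk i) i' = 0 := by
  rw [QE_apply_eq_sum_qwt]
  refine Finset.sum_eq_zero fun f _ => ?_
  by_cases hf : f.src ∈ iterBlock (lvl hN D hk i) (base hN D hk i)
  · rw [qwt_eq_zero_of_not_mem hN D hk i' (fun h => Finset.disjoint_left.1 h1 h hf) (fun h => Finset.disjoint_left.1 h2 h hf), zero_mul]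
  · have : bump hN D hk i f = 0 := by
      show bumpFn hN D hk i f = 0
      unfold bumpFn; rw [if_neg (fun h => hf h.2)]
    rw [this, mul_zero]

end Pairings

/-! ## §5  The rows of the pairing matrix: mass, the same-level partner, the level window -/

section Rows

open B5Eq118OneStroke (iterBlock iterBlockOf mem_iterBlock mem_iterBlock_iff)
open B6MultiLevelBoxOperator (N0)
open B6MultiLevelTorusOperatorL0 (TDomains)
open B6GlobalChartV1 (PV toBox)
open B6GlobalChartV1L0 (domT)
open B6AgreeQaQV1Chart (iterBlock_nonempty)
open B6Ineq2142KLevelV1 (cQ cQ_pos iterBlockOf_runSite_mem shift_injective)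
open B6Ineq2142KLevelV1L0 (lvl lvl_le_mK base qwt qwt_nonneg exists_of_qwt_ne_zero lev_le_of_ends pred_le_lev_of_ends lev_eq_of_base)

variable {d ℓ m K : ℕ} {hd : 1 ≤ d + 1} {hL : Odd (ℓ + 1) ∧ 1 < ℓ + 1}
variable {Mh k R : ℕ} {P' : Fin (d + 1) → ℕ}
variable (hN : ∀ μ, N0 ℓ Mh k P' μ = (PV d ℓ m K hd hL).sitesPerDir 0) (D : TDomains d ℓ Mh k P' R) (hk : k ≤ m + K)

/-- the two affine coefficients in case A (`b₋ ∈ Ω_j`): `ctr + 1 = L^j − r`, `L^j − 1 − ctr = r`. [cite: Balaban1984PropagatorsII, (2.147) p.248, bookkeeping] -/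
theorem ctr_caseA (i : BondIdx (domT hN D hk)) (hA : i.1.2.src ∈ (domT hN D hk).Om (lvl hN D hk i)) :
    (ctr hN D hk i : ℝ) + 1 = (((ℓ + 1) ^ (lvl hN D hk i) : ℕ) : ℝ) - rad hN D hk i ∧
      (((ℓ + 1) ^ (lvl hN D hk i) : ℕ) : ℝ) - 1 - ctr hN D hk i = rad hN D hk i := by
  have h5 := five_mul_rad_le hN D hk i
  have hS : 1 ≤ (ℓ + 1) ^ (lvl hN D hk i) := Nat.one_le_pow _ _ (by omega)
  have hc : ctr hN D hk i = (ℓ + 1) ^ (lvl hN D hk i) - 1 - rad hN D hk i := by unfold ctr; rw [if_pos hA]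
  have hcast : (ctr hN D hk i : ℝ) = (((ℓ + 1) ^ (lvl hN D hk i) : ℕ) : ℝ) - 1 - rad hN D hk i := by
    rw [hc, Nat.cast_sub (by omega), Nat.cast_sub hS]; push_cast; ring
  constructor <;> linarith

/-- the two affine coefficients in case B (`b₋ ∉ Ω_j`): `ctr + 1 = r`, `L^j − 1 − ctr = L^j − r`. [cite: Balaban1984PropagatorsII, (2.147) p.248, bookkeeping] -/
theorem ctr_caseB (hℓ : 4 ≤ ℓ) (i : BondIdx (domT hN D hk)) (hB : i.1.2.src ∉ (domT hN D hk).Om (lvl hN D hk i)) :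
    (ctr hN D hk i : ℝ) + 1 = rad hN D hk i ∧
      (((ℓ + 1) ^ (lvl hN D hk i) : ℕ) : ℝ) - 1 - ctr hN D hk i = (((ℓ + 1) ^ (lvl hN D hk i) : ℕ) : ℝ) - rad hN D hk i := by
  have hr := one_le_rad hN D hk hℓ i (one_le_lvl_of_not_mem hN D hk i hB)
  have hc : ctr hN D hk i = rad hN D hk i - 1 := by unfold ctr; rw [if_neg hB]
  have hcast : (ctr hN D hk i : ℝ) = (rad hN D hk i : ℝ) - 1 := by rw [hc, Nat.cast_sub hr]; push_cast; ring
  constructor <;> linarith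

/-- the base block is the source block in case A, the target block in case B. [cite: Balaban1984PropagatorsII, (2.3) p.224, bookkeeping] -/
theorem base_eq_src_of (i : BondIdx (B6GlobalChartV1L0.domT hN D hk)) (hA : i.1.2.src ∈ (domT hN D hk).Om (lvl hN D hk i)) : base hN D hk i = i.1.2.src := by
  unfold base; rw [if_pos hA]

/-- companion of `base_eq_src_of`. [cite: Balaban1984PropagatorsII, (2.3) p.224, bookkeeping] -/
theorem base_eq_tgt_of (i : BondIdx (B6GlobalChartV1L0.domT hN D hk)) (hB : i.1.2.src ∉ (domT hN D hk).Om (lvl hN D hk i)) : base hN D hk i = i.1.2.tgt := by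
  unfold base; rw [if_neg hB]

/-- `Στ > 0` (the centre term is `r̂ ≥ 1`; LEVEL-0 TWIN: unconditional). [cite: Balaban1984PropagatorsII, (2.147) p.248, bookkeeping] -/
theorem tsumL_pos (i : BondIdx (domT hN D hk)) : 0 < tsumL hN D hk i := by
  have hr := one_le_erad hN D hk i
  have hfit := ctr_fit' hN D hk i
  have hc : ctr hN D hk i < (ℓ + 1) ^ (lvl hN D hk i) := by omega
  unfold tsumL
  have hle := Finset.single_le_sum (f := fun t : Fin ((ℓ + 1) ^ (lvl hN D hk i)) => tauL hN D hk i t) (fun t _ => tauL_nonneg hN D hk i t)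
    (Finset.mem_univ (⟨ctr hN D hk i, hc⟩ : Fin ((ℓ + 1) ^ (lvl hN D hk i))))
  refine lt_of_lt_of_le ?_ hle
  show 0 < tauL hN D hk i (ctr hN D hk i)
  unfold tauL; simp only [sub_self, abs_zero, sub_zero]
  rw [lt_max_iff]; right; exact_mod_cast hr

/-- **THE MASS `m_i = (Qφ_i)_i = c_Q·(L^j − r)·Στ·(Στ_⊥)^d`** in both cases. [cite: Balaban1984PropagatorsII, (2.147) p.248; Balaban1984PropagatorsI, (1.18) p.20] -/
theorem mass_eq (hℓ : 4 ≤ ℓ) (i : BondIdx (domT hN D hk)) (hper : 2 ≤ (PV d ℓ m K hd hL).sitesPerDir (lvl hN D hk i)) :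
    QE (domT hN D hk) (bump hN D hk i) i =
      cQ (d := d) (ℓ := ℓ) (lvl hN D hk i) * ((((ℓ + 1) ^ (lvl hN D hk i) : ℕ) : ℝ) - rad hN D hk i) * tsumL hN D hk i *
        Tsum (ℓ := ℓ) (lvl hN D hk i) ^ d := by
  by_cases hA : i.1.2.src ∈ (domT hN D hk).Om (lvl hN D hk i)
  · rw [pair_src hN D hk i i hper rfl rfl (by rw [base_eq_src_of hN D hk i hA]), (ctr_caseA hN D hk i hA).1]
  · rw [pair_tgt hN D hk i i hper rfl rfl (by rw [base_eq_tgt_of hN D hk i hA]), (ctr_caseB hN D hk hℓ i hA).2]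

/-- `m_i > 0`. [cite: Balaban1984PropagatorsII, (2.147) p.248, bookkeeping] -/
theorem mass_pos (hℓ : 4 ≤ ℓ) (i : BondIdx (domT hN D hk)) (hper : 2 ≤ (PV d ℓ m K hd hL).sitesPerDir (lvl hN D hk i)) :
    0 < QE (domT hN D hk) (bump hN D hk i) i := by
  rw [mass_eq hN D hk hℓ i hper]
  have h5 := five_mul_rad_le hN D hk i
  have hr : 1 ≤ (ℓ + 1) ^ (lvl hN D hk i) := Nat.one_le_pow _ _ (by omega)
  have hSr : (0 : ℝ) < (((ℓ + 1) ^ (lvl hN D hk i) : ℕ) : ℝ) - rad hN D hk i := by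
    have : rad hN D hk i < (ℓ + 1) ^ (lvl hN D hk i) := by omega
    have := (Nat.cast_lt (α := ℝ)).2 this; linarith
  have h1 := tsumL_pos hN D hk i
  have h2 := Tsum_pos (ℓ := ℓ) (lvl hN D hk i)
  have h3 := cQ_pos (d := d) (ℓ := ℓ) (lvl hN D hk i)
  positivity

/-- **THE SAME-LEVEL PARTNER**: a level-`j`, direction-`μ_i` index bond `i′ ≠ i` one of whose end blocks is the base block of `i` pairs with `φ_i` to
EXACTLY `c_Q·r·Στ·(Στ_⊥)^d = (r/(L^j − r))·m_i` (in case A it is `⟨b₋ − e_μ, b₋⟩` seeing `B(b₋)` as its target block, in case B it is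
`⟨b₊, b₊ + e_μ⟩` seeing `B(b₊)` as its source block). [cite: Balaban1984PropagatorsII, (2.147) p.248; Balaban1984PropagatorsI, (1.18) p.20] -/
theorem partner_eq (hℓ : 4 ≤ ℓ) (i i' : BondIdx (domT hN D hk)) (hper : 2 ≤ (PV d ℓ m K hd hL).sitesPerDir (lvl hN D hk i'))
    (hj : lvl hN D hk i' = lvl hN D hk i) (hdir : i'.1.2.dir = i.1.2.dir) (hne : i' ≠ i)
    (h : iterBlock (lvl hN D hk i') i'.1.2.src = iterBlock (lvl hN D hk i) (base hN D hk i) ∨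
      iterBlock (lvl hN D hk i') i'.1.2.tgt = iterBlock (lvl hN D hk i) (base hN D hk i)) :
    QE (domT hN D hk) (bump hN D hk i) i' = cQ (d := d) (ℓ := ℓ) (lvl hN D hk i) * rad hN D hk i * tsumL hN D hk i * Tsum (ℓ := ℓ) (lvl hN D hk i) ^ d := by
  -- the index bonds as level/bond pairs
  obtain ⟨⟨j₁, b₁⟩, hb₁⟩ := i'
  obtain ⟨⟨j₀, b₀⟩, hb₀⟩ := i
  have hjj : j₁ = j₀ := Fin.ext (by simpa [lvl] using hj)
  subst hjj
  simp only at hdir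
  -- `i′ = i` would follow from equal sources
  have hsrc_ne : b₁.src ≠ b₀.src := by
    intro hs
    apply hne
    have : b₁ = b₀ := by cases b₁; cases b₀; simp only at hs hdir; simp [hs, hdir]
    subst this; rfl
  rcases h with h | h
  · -- source-type: then case B for `i` (else `b₁.src = b₀.src`)
    rw [pair_src hN D hk _ _ hper hj hdir h]
    by_cases hA : b₀.src ∈ (domT hN D hk).Om (lvl hN D hk ⟨⟨j₁, b₀⟩, hb₀⟩)
    · exfalso
      rw [base_eq_src_of hN D hk _ hA] at h
      exact hsrc_ne (iterBlock_injective (lvl_le_mK hN D hk ⟨⟨j₁, b₀⟩, hb₀⟩) h)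
    · rw [(ctr_caseB hN D hk hℓ _ hA).1]
  · -- target-type: then case A for `i` (else `b₁.tgt = b₀.tgt`)
    rw [pair_tgt hN D hk _ _ hper hj hdir h]
    by_cases hA : b₀.src ∈ (domT hN D hk).Om (lvl hN D hk ⟨⟨j₁, b₀⟩, hb₀⟩)
    · rw [(ctr_caseA hN D hk _ hA).2]
    · exfalso
      rw [base_eq_tgt_of hN D hk _ hA] at h
      have htgt : b₁.tgt = b₀.tgt := iterBlock_injective (lvl_le_mK hN D hk ⟨⟨j₁, b₀⟩, hb₀⟩) h
      unfold PBond.tgt at htgt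
      rw [hdir] at htgt
      exact hsrc_ne (shift_injective b₀.dir htgt)

/-- hence **the partner pairing is at most a quarter of the mass** (`r/(L^j − r) ≤ 1/4` as `5r ≤ L^j`). [cite: Balaban1984PropagatorsII, (2.147) p.248, bookkeeping] -/
theorem partner_le (hℓ : 4 ≤ ℓ) (i i' : BondIdx (domT hN D hk)) (hper' : 2 ≤ (PV d ℓ m K hd hL).sitesPerDir (lvl hN D hk i'))
    (hper : 2 ≤ (PV d ℓ m K hd hL).sitesPerDir (lvl hN D hk i))
    (hj : lvl hN D hk i' = lvl hN D hk i) (hdir : i'.1.2.dir = i.1.2.dir) (hne : i' ≠ i)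
    (h : iterBlock (lvl hN D hk i') i'.1.2.src = iterBlock (lvl hN D hk i) (base hN D hk i) ∨
      iterBlock (lvl hN D hk i') i'.1.2.tgt = iterBlock (lvl hN D hk i) (base hN D hk i)) :
    0 ≤ QE (domT hN D hk) (bump hN D hk i) i' ∧ QE (domT hN D hk) (bump hN D hk i) i' ≤ (1 / 4) * QE (domT hN D hk) (bump hN D hk i) i := by
  rw [partner_eq hN D hk hℓ i i' hper' hj hdir hne h, mass_eq hN D hk hℓ i hper]
  have h5 := five_mul_rad_le hN D hk i
  have h5' : 5 * (rad hN D hk i : ℝ) ≤ (((ℓ + 1) ^ (lvl hN D hk i) : ℕ) : ℝ) := by exact_mod_cast h5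
  have hc := cQ_pos (d := d) (ℓ := ℓ) (lvl hN D hk i)
  have ht : 0 < tsumL hN D hk i * Tsum (ℓ := ℓ) (lvl hN D hk i) ^ d :=
    mul_pos (tsumL_pos hN D hk i) (pow_pos (Tsum_pos (ℓ := ℓ) _) _)
  have hr0 : (0 : ℝ) ≤ rad hN D hk i := Nat.cast_nonneg _
  constructor
  · have := mul_nonneg (mul_nonneg hc.le hr0) ht.le
    calc (0 : ℝ) ≤ cQ (d := d) (ℓ := ℓ) (lvl hN D hk i) * rad hN D hk i * (tsumL hN D hk i * Tsum (ℓ := ℓ) (lvl hN D hk i) ^ d) := this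
      _ = _ := by ring
  · have key : cQ (d := d) (ℓ := ℓ) (lvl hN D hk i) * rad hN D hk i * (tsumL hN D hk i * Tsum (ℓ := ℓ) (lvl hN D hk i) ^ d) ≤
        (1 / 4) * (cQ (d := d) (ℓ := ℓ) (lvl hN D hk i) * ((((ℓ + 1) ^ (lvl hN D hk i) : ℕ) : ℝ) - rad hN D hk i) *
          (tsumL hN D hk i * Tsum (ℓ := ℓ) (lvl hN D hk i) ^ d)) := by
      rw [← mul_assoc (1 / 4 : ℝ), ← mul_assoc (1 / 4 : ℝ)]
      refine mul_le_mul_of_nonneg_right ?_ ht.le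
      rw [mul_assoc (1 / 4 : ℝ), mul_left_comm]
      refine mul_le_mul_of_nonneg_left ?_ hc.le
      linarith
    calc cQ (d := d) (ℓ := ℓ) (lvl hN D hk i) * rad hN D hk i * tsumL hN D hk i * Tsum (ℓ := ℓ) (lvl hN D hk i) ^ d
        = cQ (d := d) (ℓ := ℓ) (lvl hN D hk i) * rad hN D hk i * (tsumL hN D hk i * Tsum (ℓ := ℓ) (lvl hN D hk i) ^ d) := by ring
      _ ≤ _ := key
      _ = _ := by ring

/-- **THE LEVEL WINDOW**: `(Qφ_i)_{i′} ≠ 0 ⇒ j(i) ≤ j(i′) ≤ j(i) + 1` (the double block of `i′` has site levels in `{j(i′) − 1, j(i′)}`, the base block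
of `i` has level `j(i)`). [cite: Balaban1984PropagatorsII, (2.1)–(2.3) p.224, (2.45) p.231] -/
theorem level_window (hRM : 2 ≤ R * Mh) (i i' : BondIdx (domT hN D hk)) (hne0 : QE (domT hN D hk) (bump hN D hk i) i' ≠ 0) :
    lvl hN D hk i ≤ lvl hN D hk i' ∧ lvl hN D hk i' ≤ lvl hN D hk i + 1 := by
  classical
  rw [QE_apply_eq_sum_qwt] at hne0
  obtain ⟨f, -, hf⟩ := Finset.exists_ne_zero_of_sum_ne_zero hne0
  have hq : qwt hN D hk i' f ≠ 0 := left_ne_zero_of_mul hf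
  have hb : bump hN D hk i f ≠ 0 := right_ne_zero_of_mul hf
  have hsrc : f.src ∈ iterBlock (lvl hN D hk i) (base hN D hk i) := by
    by_contra h
    apply hb
    show bumpFn hN D hk i f = 0
    unfold bumpFn; rw [if_neg (fun h' => h h'.2)]
  rw [mem_iterBlock] at hsrc
  have hlev := lev_eq_of_base hN D hk i hsrc
  obtain ⟨x, hx, t, ht, hxt⟩ := exists_of_qwt_ne_zero hN D hk i' hq
  rw [mem_iterBlock] at hx
  have hends : iterBlockOf (lvl hN D hk i') f.src = i'.1.2.src ∨ iterBlockOf (lvl hN D hk i') f.src = i'.1.2.tgt := by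
    have hs : f.src = runSite x i'.1.2.dir t := by rw [← hxt]; rfl
    rcases iterBlockOf_runSite_mem (lvl_le_mK hN D hk i') x i'.1.2.dir ht.le with h' | h'
    · left; rw [hs, h', hx]
    · right; rw [hs, h', hx]; rfl
  have h1 := lev_le_of_ends hN D hk i' hends
  have h2 := pred_le_lev_of_ends hN D hk hRM i' hends
  constructor <;> omega

end Rows

/-! ## §6b  Locality: how many bumps a bond / a `Q`-row can see (fibres of `β`, W3; blocks met by a double block, W2) -/

section Locality

open B5Eq118OneStroke (iterBlock iterBlockOf mem_iterBlock)
open B6MultiLevelBoxOperator (N0)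
open B6MultiLevelTorusOperatorL0 (TDomains)
open B6GlobalChartV1 (PV toBox)
open B6GlobalChartV1L0 (domT)
open B6Geom246MultiLevelBoxL0 (bset blkOf)
open B6Ineq2142KLevelV1 (iterBlockOf_runSite_mem)
open B6Ineq2142KLevelV1L0 (lvl lvl_le_mK base β blkOf_eq_beta qwt exists_of_qwt_ne_zero metBlocks mem_metBlocks card_metBlocks_le)
open B6Prop27KLevelV1L0 (card_fiber_beta_le)

variable {d ℓ m K : ℕ} {hd : 1 ≤ d + 1} {hL : Odd (ℓ + 1) ∧ 1 < ℓ + 1}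
variable {Mh k R : ℕ} {P' : Fin (d + 1) → ℕ}
variable (hN : ∀ μ, N0 ℓ Mh k P' μ = (PV d ℓ m K hd hL).sitesPerDir 0) (D : TDomains d ℓ Mh k P' R) (hk : k ≤ m + K)

/-- where a bump is nonzero: direction `μ_i`, source in the base block. [cite: Balaban1984PropagatorsII, (2.147) p.248, bookkeeping] -/
theorem bump_ne_zero_imp (i : BondIdx (domT hN D hk)) {f : PBond (PV d ℓ m K hd hL) 0} (h : bump hN D hk i f ≠ 0) :
    f.dir = i.1.2.dir ∧ f.src ∈ iterBlock (lvl hN D hk i) (base hN D hk i) := by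
  by_contra hc
  apply h
  show bumpFn hN D hk i f = 0
  unfold bumpFn; rw [if_neg hc]

/-- the carrier block of a bump seeing the bond `f` is the `𝔅`-block of `f₋`. [cite: Balaban1984PropagatorsII, (2.45) p.231, bookkeeping] -/
theorem beta_eq_of_bump_ne_zero (i : BondIdx (domT hN D hk)) {f : PBond (PV d ℓ m K hd hL) 0} (h : bump hN D hk i f ≠ 0) :
    β hN D hk i = blkOf D.toDomains (toBox hN f.src) := by
  have h2 := (bump_ne_zero_imp hN D hk i h).2
  rw [mem_iterBlock] at h2
  exact (blkOf_eq_beta hN D hk i h2).symm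

/-- **AT MOST `2D` BUMPS ARE NONZERO ON A GIVEN BOND.** [cite: Balaban1984PropagatorsII, (2.147) p.248, (2.45) p.231, bookkeeping] -/
theorem card_bump_support_le (f : PBond (PV d ℓ m K hd hL) 0) :
    (Finset.univ.filter fun i : BondIdx (domT hN D hk) => bump hN D hk i f ≠ 0).card ≤ 2 * (d + 1) := by
  classical
  refine le_trans (Finset.card_le_card fun i hi => ?_) (card_fiber_beta_le hN D hk (blkOf D.toDomains (toBox hN f.src)))
  rw [Finset.mem_filter] at hi ⊢
  exact ⟨hi.1, beta_eq_of_bump_ne_zero hN D hk i hi.2⟩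

/-- **THE GRADIENT OF A SUPERPOSITION OF BUMPS IS LOCAL**: `(Σ_i a_i(Δ_νφ_i)(f))² ≤ 4D·Σ_i a_i²(Δ_νφ_i)(f)²`.
[cite: Balaban1984PropagatorsII, (2.147) p.248, bookkeeping] -/
theorem grad_sq_le (a : BondIdx (domT hN D hk) → ℝ) (f : PBond (PV d ℓ m K hd hL) 0) (ν : Fin (d + 1)) :
    (∑ i, a i * bdiff (bump hN D hk i) ν f) ^ 2 ≤ (4 * ((d : ℝ) + 1)) * ∑ i, (a i * bdiff (bump hN D hk i) ν f) ^ 2 := by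
  classical
  set S := (Finset.univ.filter fun i : BondIdx (domT hN D hk) => bump hN D hk i f ≠ 0) ∪
    (Finset.univ.filter fun i : BondIdx (domT hN D hk) => bump hN D hk i ⟨f.src.shift ν, f.dir⟩ ≠ 0) with hSdef
  have hS : ∀ i, bdiff (bump hN D hk i) ν f ≠ 0 → i ∈ S := by
    intro i hi
    rw [hSdef, Finset.mem_union, Finset.mem_filter, Finset.mem_filter]
    by_contra hc
    rw [not_or] at hc
    apply hi
    unfold bdiff
    have h1 : bump hN D hk i ⟨f.src.shift ν, f.dir⟩ = 0 := by by_contra h; exact hc.2 ⟨Finset.mem_univ _, h⟩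
    have h2 : bump hN D hk i f = 0 := by by_contra h; exact hc.1 ⟨Finset.mem_univ _, h⟩
    rw [h1, h2, sub_zero]
  have hcard : (S.card : ℝ) ≤ 4 * ((d : ℝ) + 1) := by
    have h := (Finset.card_union_le _ _).trans (Nat.add_le_add (card_bump_support_le hN D hk f) (card_bump_support_le hN D hk ⟨f.src.shift ν, f.dir⟩))
    rw [hSdef]
    have : (S.card : ℝ) ≤ ((2 * (d + 1) + 2 * (d + 1) : ℕ) : ℝ) := by rw [hSdef]; exact_mod_cast h
    push_cast at this; linarith
  refine (sq_sum_le_card_support_mul a _ S hS).trans ?_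
  exact mul_le_mul_of_nonneg_right hcard (Finset.sum_nonneg fun i _ => sq_nonneg _)

/-- a bump seen by the `Q`-row of `i′` has its carrier block among the blocks met by the double block of `i′`. [cite: Balaban1984PropagatorsII, (2.45) p.231, bookkeeping] -/
theorem beta_mem_metBlocks_of_pair_ne_zero (i i' : BondIdx (domT hN D hk)) (h : QE (domT hN D hk) (bump hN D hk i) i' ≠ 0) :
    β hN D hk i ∈ metBlocks hN D hk i' := by
  classical
  rw [QE_apply_eq_sum_qwt] at h
  obtain ⟨f, -, hf⟩ := Finset.exists_ne_zero_of_sum_ne_zero h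
  have hq : qwt hN D hk i' f ≠ 0 := left_ne_zero_of_mul hf
  have hb : bump hN D hk i f ≠ 0 := right_ne_zero_of_mul hf
  rw [beta_eq_of_bump_ne_zero hN D hk i hb]
  obtain ⟨x, hx, t, ht, hxt⟩ := exists_of_qwt_ne_zero hN D hk i' hq
  rw [mem_iterBlock] at hx
  refine mem_metBlocks hN D hk i' ?_
  have hs : f.src = runSite x i'.1.2.dir t := by rw [← hxt]; rfl
  rcases iterBlockOf_runSite_mem (lvl_le_mK hN D hk i') x i'.1.2.dir ht.le with h' | h'
  · left; rw [hs, h', hx]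
  · right; rw [hs, h', hx]; rfl

/-- **AT MOST `4D·L^D` BUMPS ARE SEEN BY ONE `Q`-ROW.** [cite: Balaban1984PropagatorsII, (2.45) p.231, (2.147) p.248, bookkeeping] -/
theorem card_pair_support_le (hRM : 2 ≤ R * Mh) (i' : BondIdx (domT hN D hk)) :
    (Finset.univ.filter fun i : BondIdx (domT hN D hk) => QE (domT hN D hk) (bump hN D hk i) i' ≠ 0).card ≤
      2 * (ℓ + 1) ^ (d + 1) * (2 * (d + 1)) := by
  classical
  have hsub : (Finset.univ.filter fun i : BondIdx (domT hN D hk) => QE (domT hN D hk) (bump hN D hk i) i' ≠ 0) ⊆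
      (metBlocks hN D hk i').biUnion fun y => Finset.univ.filter fun i : BondIdx (domT hN D hk) => β hN D hk i = y := by
    intro i hi
    rw [Finset.mem_filter] at hi
    rw [Finset.mem_biUnion]
    exact ⟨β hN D hk i, beta_mem_metBlocks_of_pair_ne_zero hN D hk i i' hi.2, by rw [Finset.mem_filter]; exact ⟨Finset.mem_univ _, rfl⟩⟩
  refine (Finset.card_le_card hsub).trans (Finset.card_biUnion_le.trans ?_)
  refine (Finset.sum_le_sum fun y _ => card_fiber_beta_le hN D hk y).trans ?_
  rw [Finset.sum_const, smul_eq_mul]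
  exact Nat.mul_le_mul_right _ (card_metBlocks_le hN D hk hRM i')

/-- **THE `Q`-ROWS OF A SUPERPOSITION OF BUMPS ARE LOCAL**: `(Σ_i a_i(Qφ_i)_{i′})² ≤ 4D·L^D·Σ_i a_i²(Qφ_i)_{i′}²`.
[cite: Balaban1984PropagatorsII, (2.147) p.248, bookkeeping] -/
theorem qrow_sq_le (hRM : 2 ≤ R * Mh) (a : BondIdx (domT hN D hk) → ℝ) (i' : BondIdx (domT hN D hk)) :
    (∑ i, a i * QE (domT hN D hk) (bump hN D hk i) i') ^ 2 ≤
      (4 * ((d : ℝ) + 1) * (((ℓ + 1 : ℕ) : ℝ)) ^ (d + 1)) * ∑ i, (a i * QE (domT hN D hk) (bump hN D hk i) i') ^ 2 := by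
  classical
  set S := Finset.univ.filter fun i : BondIdx (domT hN D hk) => QE (domT hN D hk) (bump hN D hk i) i' ≠ 0 with hSdef
  have hS : ∀ i, QE (domT hN D hk) (bump hN D hk i) i' ≠ 0 → i ∈ S := fun i hi => by rw [Finset.mem_filter]; exact ⟨Finset.mem_univ _, hi⟩
  have hcard : (S.card : ℝ) ≤ 4 * ((d : ℝ) + 1) * (((ℓ + 1 : ℕ) : ℝ)) ^ (d + 1) := by
    have h : S.card ≤ 2 * (ℓ + 1) ^ (d + 1) * (2 * (d + 1)) := by rw [hSdef]; exact card_pair_support_le hN D hk hRM i'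
    have : (S.card : ℝ) ≤ ((2 * (ℓ + 1) ^ (d + 1) * (2 * (d + 1)) : ℕ) : ℝ) := by exact_mod_cast h
    push_cast at this
    have hL : (((ℓ + 1 : ℕ) : ℝ)) = (ℓ : ℝ) + 1 := by push_cast; ring
    rw [hL]; linarith
  refine (sq_sum_le_card_support_mul a _ S hS).trans ?_
  exact mul_le_mul_of_nonneg_right hcard (Finset.sum_nonneg fun i _ => sq_nonneg _)

end Locality

/-! ## §5b  Index bonds are determined by (level, direction, source block); the total same-level weight on a base block -/

section Keys

open B5Eq118OneStroke (iterBlock iterBlockOf mem_iterBlock mem_iterBlock_iff)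
open B6MultiLevelBoxOperator (N0)
open B6MultiLevelTorusOperatorL0 (TDomains)
open B6GlobalChartV1 (PV)
open B6GlobalChartV1L0 (domT)
open B6Ineq2142KLevelV1 (cQ cQ_pos iterBlockOf_runSite_mem shift_injective)
open B6Ineq2142KLevelV1L0 (lvl lvl_le_mK base qwt qwt_nonneg qwt_eq_sum exists_of_qwt_ne_zero)

variable {d ℓ m K : ℕ} {hd : 1 ≤ d + 1} {hL : Odd (ℓ + 1) ∧ 1 < ℓ + 1}
variable {Mh k R : ℕ} {P' : Fin (d + 1) → ℕ}
variable (hN : ∀ μ, N0 ℓ Mh k P' μ = (PV d ℓ m K hd hL).sitesPerDir 0) (D : TDomains d ℓ Mh k P' R) (hk : k ≤ m + K)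

/-- the source block of an index bond as a set of fine sites (a type-uniform key). [cite: Balaban1984PropagatorsII, (2.3)/(2.20) p.224–226, bookkeeping] -/
def srcBlk (i : BondIdx (domT hN D hk)) : Finset (Site (PV d ℓ m K hd hL) 0) := iterBlock (lvl hN D hk i) i.1.2.src

/-- **AN INDEX BOND IS DETERMINED BY ITS LEVEL, DIRECTION AND SOURCE BLOCK.** [cite: Balaban1984PropagatorsII, (2.3)/(2.20) p.224–226, bookkeeping] -/
theorem ext_of_key {i i' : BondIdx (domT hN D hk)} (hj : lvl hN D hk i = lvl hN D hk i') (hdir : i.1.2.dir = i'.1.2.dir)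
    (hblk : srcBlk hN D hk i = srcBlk hN D hk i') : i = i' := by
  obtain ⟨⟨j₀, b₀⟩, hb₀⟩ := i
  obtain ⟨⟨j₁, b₁⟩, hb₁⟩ := i'
  have hjj : j₀ = j₁ := Fin.ext (by simpa [lvl] using hj)
  subst hjj
  simp only at hdir
  unfold srcBlk at hblk
  have hsrc : b₀.src = b₁.src := iterBlock_injective (lvl_le_mK hN D hk ⟨⟨j₀, b₀⟩, hb₀⟩) hblk
  have hb : b₀ = b₁ := by cases b₀; cases b₁; simp only at hsrc hdir; simp [hsrc, hdir]
  subst hb; rfl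

/-- hence at most one index bond has a given (level, direction, source block). [cite: Balaban1984PropagatorsII, (2.3)/(2.20) p.224–226, bookkeeping] -/
theorem card_key_le_one (n : ℕ) (μ : Fin (d + 1)) (B : Finset (Site (PV d ℓ m K hd hL) 0)) :
    (Finset.univ.filter fun i : BondIdx (domT hN D hk) => lvl hN D hk i = n ∧ i.1.2.dir = μ ∧ srcBlk hN D hk i = B).card ≤ 1 := by
  classical
  refine Finset.card_le_one.2 fun i hi i' hi' => ?_
  rw [Finset.mem_filter] at hi hi'
  exact ext_of_key hN D hk (hi.2.1.trans hi'.2.1.symm) (hi.2.2.1.trans hi'.2.2.1.symm) (hi.2.2.2.trans hi'.2.2.2.symm)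

/-- **THE TOTAL SAME-LEVEL WEIGHT ON A FINE BOND IS AT MOST `c_Q·L^j`**: the level-`n`, direction-`μ` index bonds weighting the bond `⟨z, μ⟩` are
`⟨y(z), y(z)+e_μ⟩` (weight `c_Q(loc+1)`) and `⟨y(z)−e_μ, y(z)⟩` (weight `c_Q(L^n−1−loc)`). [cite: Balaban1984PropagatorsI, (1.18) p.20; Balaban1984PropagatorsII, (2.20) p.226] -/
theorem sum_qwt_level_le (n : ℕ) (hper : 2 ≤ (PV d ℓ m K hd hL).sitesPerDir n) (z : Site (PV d ℓ m K hd hL) 0) (μ : Fin (d + 1)) :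
    ∑ i' ∈ Finset.univ.filter (fun i' : BondIdx (B6GlobalChartV1L0.domT hN D hk) => lvl hN D hk i' = n), qwt hN D hk i' ⟨z, μ⟩ ≤
      cQ (d := d) (ℓ := ℓ) n * (((ℓ + 1) ^ n : ℕ) : ℝ) := by
  classical
  by_cases hn : n ≤ m + K
  swap
  · -- no index bond has such a level
    have : Finset.univ.filter (fun i' : BondIdx (domT hN D hk) => lvl hN D hk i' = n) = ∅ := by
      refine Finset.filter_eq_empty_iff.2 fun i' _ h => hn ?_
      rw [← h]; exact lvl_le_mK hN D hk i'
    rw [this, Finset.sum_empty]; exact mul_nonneg (cQ_pos (d := d) (ℓ := ℓ) n).le (Nat.cast_nonneg _)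
  set y := iterBlockOf n z
  have hz : z ∈ iterBlock n y := by rw [mem_iterBlock]
  -- split the level-`n` bonds into: source block `B(y)`, source block `B(y − e_μ)` with direction `μ`, and the rest (weight 0)
  set A := Finset.univ.filter (fun i' : BondIdx (domT hN D hk) => lvl hN D hk i' = n ∧ i'.1.2.dir = μ ∧ srcBlk hN D hk i' = iterBlock n y)
  set Bset := Finset.univ.filter (fun i' : BondIdx (domT hN D hk) => lvl hN D hk i' = n ∧ i'.1.2.dir = μ ∧ srcBlk hN D hk i' = iterBlock n (y.unshift μ))
  have hA := card_key_le_one hN D hk n μ (iterBlock n y)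
  have hB := card_key_le_one hN D hk n μ (iterBlock n (y.unshift μ))
  have hval : ∀ i' ∈ Finset.univ.filter (fun i' : BondIdx (domT hN D hk) => lvl hN D hk i' = n), qwt hN D hk i' ⟨z, μ⟩ ≤
      (if i' ∈ A then cQ (d := d) (ℓ := ℓ) n * ((loc n z μ : ℝ) + 1) else 0) +
        (if i' ∈ Bset then cQ (d := d) (ℓ := ℓ) n * ((((ℓ + 1) ^ n - 1 - loc n z μ : ℕ) : ℝ)) else 0) := by
    intro i' hi'
    rw [Finset.mem_filter] at hi'
    have hlv : lvl hN D hk i' = n := hi'.2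
    by_cases hq : qwt hN D hk i' ⟨z, μ⟩ = 0
    · rw [hq]; refine add_nonneg ?_ ?_ <;> split_ifs
      · exact mul_nonneg (cQ_pos (d := d) (ℓ := ℓ) n).le (by positivity)
      · exact le_rfl
      · exact mul_nonneg (cQ_pos (d := d) (ℓ := ℓ) n).le (Nat.cast_nonneg _)
      · exact le_rfl
    · -- direction `μ` and `z` in the double block of `i′`
      have hdir : i'.1.2.dir = μ := by
        by_contra h; exact hq (qwt_eq_zero_of_dir_ne hN D hk i' (f := ⟨z, μ⟩) (fun h' => h h'.symm))
      obtain ⟨x, hx, t, ht, hxt⟩ := exists_of_qwt_ne_zero hN D hk i' hq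
      rw [mem_iterBlock] at hx
      have hzs : z = runSite x i'.1.2.dir t := by
        have := congrArg PBond.src hxt; exact this.symm
      rcases iterBlockOf_runSite_mem (lvl_le_mK hN D hk i') x i'.1.2.dir ht.le with h' | h'
      · -- `z ∈ B(src′)`: `i′ ∈ A`, weight `c_Q(loc + 1)`
        have hzsrc : z ∈ iterBlock (lvl hN D hk i') i'.1.2.src := by rw [mem_iterBlock, hzs, h', hx]
        have hmemA : i' ∈ A := by
          rw [Finset.mem_filter]
          refine ⟨Finset.mem_univ _, hlv, hdir, ?_⟩
          unfold srcBlk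
          rw [mem_iterBlock] at hzsrc
          have : iterBlock (lvl hN D hk i') i'.1.2.src = iterBlock (lvl hN D hk i') (iterBlockOf (lvl hN D hk i') z) := by rw [hzsrc]
          rw [this, hlv]
        rw [if_pos hmemA]
        have hw := qwt_src hN D hk i' (by rw [hlv]; exact hper) hzsrc
        rw [hdir, hlv] at hw
        rw [hw]
        refine le_add_of_nonneg_right ?_
        split_ifs
        · exact mul_nonneg (cQ_pos (d := d) (ℓ := ℓ) n).le (Nat.cast_nonneg _)
        · exact le_rfl
      · -- `z ∈ B(tgt′)`: `i′ ∈ B`, weight `c_Q(L^n − 1 − loc)`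
        have hztgt : z ∈ iterBlock (lvl hN D hk i') i'.1.2.tgt := by rw [mem_iterBlock, hzs, h', hx]; rfl
        have hmemB : i' ∈ Bset := by
          rw [Finset.mem_filter]
          refine ⟨Finset.mem_univ _, hlv, hdir, ?_⟩
          unfold srcBlk
          rw [mem_iterBlock] at hztgt
          have htgt : i'.1.2.tgt = iterBlockOf (lvl hN D hk i') z := hztgt.symm
          rw [tgt_eq_iff_src_eq] at htgt
          rw [htgt, hdir]
          -- align the level
          obtain ⟨⟨j₁, b₁⟩, hb₁⟩ := i'
          simp only [lvl] at hlv ⊢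
          subst hlv
          rfl
        rw [if_pos hmemB]
        have hw := qwt_tgt hN D hk i' (by rw [hlv]; exact hper) hztgt
        rw [hdir, hlv] at hw
        rw [hw]
        refine le_add_of_nonneg_left ?_
        split_ifs
        · exact mul_nonneg (cQ_pos (d := d) (ℓ := ℓ) n).le (by positivity)
        · exact le_rfl
  refine (Finset.sum_le_sum hval).trans ?_
  rw [Finset.sum_add_distrib]
  have hSA : ∑ i' ∈ Finset.univ.filter (fun i' : BondIdx (domT hN D hk) => lvl hN D hk i' = n),
      (if i' ∈ A then cQ (d := d) (ℓ := ℓ) n * ((loc n z μ : ℝ) + 1) else 0) ≤ cQ (d := d) (ℓ := ℓ) n * ((loc n z μ : ℝ) + 1) := by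
    rw [← Finset.sum_filter]
    have hsub : ((Finset.univ.filter (fun i' : BondIdx (domT hN D hk) => lvl hN D hk i' = n)).filter fun i' => i' ∈ A) ⊆ A :=
      fun i hi => (Finset.mem_filter.1 hi).2
    calc _ ≤ ∑ i' ∈ A, cQ (d := d) (ℓ := ℓ) n * ((loc n z μ : ℝ) + 1) :=
          Finset.sum_le_sum_of_subset_of_nonneg hsub fun _ _ _ => mul_nonneg (cQ_pos (d := d) (ℓ := ℓ) n).le (by positivity)
      _ = A.card * (cQ (d := d) (ℓ := ℓ) n * ((loc n z μ : ℝ) + 1)) := by rw [Finset.sum_const, nsmul_eq_mul]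
      _ ≤ 1 * (cQ (d := d) (ℓ := ℓ) n * ((loc n z μ : ℝ) + 1)) := by
          refine mul_le_mul_of_nonneg_right ?_ (mul_nonneg (cQ_pos (d := d) (ℓ := ℓ) n).le (by positivity)); exact_mod_cast hA
      _ = _ := one_mul _
  have hSB : ∑ i' ∈ Finset.univ.filter (fun i' : BondIdx (domT hN D hk) => lvl hN D hk i' = n),
      (if i' ∈ Bset then cQ (d := d) (ℓ := ℓ) n * ((((ℓ + 1) ^ n - 1 - loc n z μ : ℕ) : ℝ)) else 0) ≤
        cQ (d := d) (ℓ := ℓ) n * ((((ℓ + 1) ^ n - 1 - loc n z μ : ℕ) : ℝ)) := by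
    rw [← Finset.sum_filter]
    have hsub : ((Finset.univ.filter (fun i' : BondIdx (domT hN D hk) => lvl hN D hk i' = n)).filter fun i' => i' ∈ Bset) ⊆ Bset :=
      fun i hi => (Finset.mem_filter.1 hi).2
    calc _ ≤ ∑ i' ∈ Bset, cQ (d := d) (ℓ := ℓ) n * ((((ℓ + 1) ^ n - 1 - loc n z μ : ℕ) : ℝ)) :=
          Finset.sum_le_sum_of_subset_of_nonneg hsub fun _ _ _ => mul_nonneg (cQ_pos (d := d) (ℓ := ℓ) n).le (Nat.cast_nonneg _)
      _ = Bset.card * (cQ (d := d) (ℓ := ℓ) n * ((((ℓ + 1) ^ n - 1 - loc n z μ : ℕ) : ℝ))) := by rw [Finset.sum_const, nsmul_eq_mul]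
      _ ≤ 1 * (cQ (d := d) (ℓ := ℓ) n * ((((ℓ + 1) ^ n - 1 - loc n z μ : ℕ) : ℝ))) := by
          refine mul_le_mul_of_nonneg_right ?_ (mul_nonneg (cQ_pos (d := d) (ℓ := ℓ) n).le (Nat.cast_nonneg _)); exact_mod_cast hB
      _ = _ := one_mul _
  refine (add_le_add hSA hSB).trans (le_of_eq ?_)
  have hlt := loc_lt n z μ
  rw [← mul_add, Nat.cast_sub (by omega), Nat.cast_sub (Nat.one_le_pow _ _ (by omega))]
  push_cast; ring

/-- **THE SAME-LEVEL ROWS OF A BUMP CARRY TOTAL WEIGHT `≤ (L^j/(L^j − r))·m_i`**: `Σ_{i′ : j(i′) = j(i)} (Qφ_i)_{i′} ≤ c_Q·L^j·Στ·(Στ_⊥)^d`.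
[cite: Balaban1984PropagatorsII, (2.147) p.248; Balaban1984PropagatorsI, (1.18) p.20] -/
theorem sum_pair_level_le (i : BondIdx (domT hN D hk)) (hper : 2 ≤ (PV d ℓ m K hd hL).sitesPerDir (lvl hN D hk i)) :
    ∑ i' ∈ Finset.univ.filter (fun i' : BondIdx (domT hN D hk) => lvl hN D hk i' = lvl hN D hk i), QE (domT hN D hk) (bump hN D hk i) i' ≤
      cQ (d := d) (ℓ := ℓ) (lvl hN D hk i) * ((((ℓ + 1) ^ (lvl hN D hk i)) : ℕ) : ℝ) * (tsumL hN D hk i * Tsum (ℓ := ℓ) (lvl hN D hk i) ^ d) := by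
  classical
  simp_rw [QE_apply_eq_sum_qwt]
  rw [Finset.sum_comm]
  -- `Σ_f (Σ_{i′} q_{i′}(f))·φ_i(f) ≤ c_Q L^j Σ_f φ_i(f)`
  have h1 : ∀ f : PBond (PV d ℓ m K hd hL) 0,
      ∑ i' ∈ Finset.univ.filter (fun i' : BondIdx (domT hN D hk) => lvl hN D hk i' = lvl hN D hk i), qwt hN D hk i' f * bump hN D hk i f ≤
        cQ (d := d) (ℓ := ℓ) (lvl hN D hk i) * ((((ℓ + 1) ^ (lvl hN D hk i)) : ℕ) : ℝ) * bump hN D hk i f := by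
    intro f
    rw [← Finset.sum_mul]
    refine mul_le_mul_of_nonneg_right ?_ (bumpFn_nonneg hN D hk i f)
    obtain ⟨z, μ⟩ := f
    exact sum_qwt_level_le hN D hk (lvl hN D hk i) hper z μ
  refine (Finset.sum_le_sum fun f _ => h1 f).trans (le_of_eq ?_)
  rw [← Finset.mul_sum, pair_le.sum_bump]

end Keys

/-! ## §6c  The `Q`-part of the energy of one bump -/

section QEnergy

open B5Eq118OneStroke (iterBlock iterBlockOf mem_iterBlock)
open B6MultiLevelBoxOperator (N0)
open B6MultiLevelTorusOperatorL0 (TDomains)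
open B6GlobalChartV1 (PV)
open B6GlobalChartV1L0 (domT)
open B6CubeWindowV1 (GlobalBand)
open B6Ineq2142KLevelV1 (cQ cQ_pos cQ_eq)
open B6Ineq2142KLevelV1L0 (lvl lvl_le lvl_le_mK base qwt qwt_nonneg)

variable {d ℓ m K : ℕ} {hd : 1 ≤ d + 1} {hL : Odd (ℓ + 1) ∧ 1 < ℓ + 1}
variable {Mh k R : ℕ} {P' : Fin (d + 1) → ℕ}
variable (hN : ∀ μ, N0 ℓ Mh k P' μ = (PV d ℓ m K hd hL).sitesPerDir 0) (D : TDomains d ℓ Mh k P' R) (hk : k ≤ m + K)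

/-- the pairings are nonnegative. [cite: Balaban1984PropagatorsI, (1.18) p.20, bookkeeping] -/
theorem pair_nonneg (i i' : BondIdx (domT hN D hk)) : 0 ≤ QE (domT hN D hk) (bump hN D hk i) i' := by
  rw [QE_apply_eq_sum_qwt]
  exact Finset.sum_nonneg fun f _ => mul_nonneg (qwt_nonneg hN D hk i' f) (bumpFn_nonneg hN D hk i f)

/-- **THE TOTAL WEIGHT OF ALL ROWS ON A BUMP**: `Σ_{i′} (Qφ_i)_{i′} ≤ 2·L^{−jD}·Στ·(Στ_⊥)^d` (levels `j` and `j + 1` only, each `≤ c_QL^{j′}·Σφ`).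
[cite: Balaban1984PropagatorsII, (2.147) p.248; Balaban1984PropagatorsI, (1.18) p.20] -/
theorem sum_pair_le (hRM : 2 ≤ R * Mh) (hper : ∀ n, n ≤ k + 1 → 2 ≤ (PV d ℓ m K hd hL).sitesPerDir n) (i : BondIdx (domT hN D hk)) :
    ∑ i', QE (domT hN D hk) (bump hN D hk i) i' ≤ 2 * ((((ℓ + 1 : ℕ) : ℝ) ^ (d + 1)) ^ (lvl hN D hk i))⁻¹ * (tsumL hN D hk i * Tsum (ℓ := ℓ) (lvl hN D hk i) ^ d) := by
  classical
  set j := lvl hN D hk i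
  set F := Finset.univ.filter (fun i' : BondIdx (domT hN D hk) => lvl hN D hk i' = j) with hF
  set G := Finset.univ.filter (fun i' : BondIdx (domT hN D hk) => lvl hN D hk i' = j + 1) with hG
  -- only levels `j`, `j+1` contribute
  have hzero : ∀ i' ∈ Finset.univ \ (F ∪ G), QE (domT hN D hk) (bump hN D hk i) i' = 0 := by
    intro i' hi'
    rw [Finset.mem_sdiff, Finset.mem_union, hF, hG, Finset.mem_filter, Finset.mem_filter] at hi'
    by_contra hne
    have hw := level_window hN D hk hRM i i' hne
    rcases Nat.eq_or_lt_of_le hw.1 with h | h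
    · exact hi'.2 (Or.inl ⟨Finset.mem_univ _, h.symm⟩)
    · exact hi'.2 (Or.inr ⟨Finset.mem_univ _, by omega⟩)
  have hdisj : Disjoint F G := by
    rw [hF, hG, Finset.disjoint_filter]; intro i' _ h1 h2; omega
  have hsplit : ∑ i', QE (domT hN D hk) (bump hN D hk i) i' = ∑ i' ∈ F, QE (domT hN D hk) (bump hN D hk i) i' + ∑ i' ∈ G, QE (domT hN D hk) (bump hN D hk i) i' := by
    rw [← Finset.sum_union hdisj, ← Finset.sum_sdiff (Finset.subset_univ (F ∪ G)), Finset.sum_eq_zero hzero, zero_add]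
  rw [hsplit]
  have hj1 : j + 1 ≤ k + 1 := Nat.succ_le_succ (lvl_le hN D hk i)
  have h1 := sum_pair_level_le hN D hk i (hper j (by omega))
  -- the level `j+1` rows: same computation with `sum_qwt_level_le` at level `j + 1`
  have h2 : ∑ i' ∈ G, QE (domT hN D hk) (bump hN D hk i) i' ≤ cQ (d := d) (ℓ := ℓ) (j + 1) * ((((ℓ + 1) ^ (j + 1)) : ℕ) : ℝ) *
      (tsumL hN D hk i * Tsum (ℓ := ℓ) j ^ d) := by
    simp_rw [QE_apply_eq_sum_qwt]
    rw [Finset.sum_comm]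
    have h1' : ∀ f : PBond (PV d ℓ m K hd hL) 0, ∑ i' ∈ G, qwt hN D hk i' f * bump hN D hk i f ≤
        cQ (d := d) (ℓ := ℓ) (j + 1) * ((((ℓ + 1) ^ (j + 1)) : ℕ) : ℝ) * bump hN D hk i f := by
      intro f
      rw [← Finset.sum_mul]
      refine mul_le_mul_of_nonneg_right ?_ (bumpFn_nonneg hN D hk i f)
      obtain ⟨z, μ⟩ := f
      exact sum_qwt_level_le hN D hk (j + 1) (hper (j + 1) hj1) z μ
    refine (Finset.sum_le_sum fun f _ => h1' f).trans (le_of_eq ?_)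
    rw [← Finset.mul_sum, pair_le.sum_bump]
  rw [cQ_mul_pow] at h1 h2
  have hmono : ((((ℓ + 1 : ℕ) : ℝ) ^ (d + 1)) ^ (j + 1))⁻¹ ≤ ((((ℓ + 1 : ℕ) : ℝ) ^ (d + 1)) ^ j)⁻¹ := by
    refine inv_anti₀ (by positivity) (pow_le_pow_right₀ ?_ (Nat.le_succ j))
    exact_mod_cast Nat.one_le_pow _ _ (by omega)
  have ht : 0 ≤ tsumL hN D hk i * Tsum (ℓ := ℓ) j ^ d :=
    mul_nonneg (Finset.sum_nonneg fun t _ => tauL_nonneg hN D hk i t) (pow_nonneg (Tsum_pos (ℓ := ℓ) j).le _)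
  nlinarith [mul_le_mul_of_nonneg_right hmono ht]

end QEnergy

section QEnergy2

open B5Eq118OneStroke (iterBlock iterBlockOf mem_iterBlock)
open B6MultiLevelBoxOperator (N0)
open B6MultiLevelTorusOperatorL0 (TDomains)
open B6GlobalChartV1 (PV)
open B6GlobalChartV1L0 (domT)
open B6Ineq2142KLevelV1 (cQ cQ_pos)
open B6Ineq2142KLevelV1L0 (lvl lvl_le lvl_le_mK base qwt qwt_nonneg)

variable {d ℓ m K : ℕ} {hd : 1 ≤ d + 1} {hL : Odd (ℓ + 1) ∧ 1 < ℓ + 1}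
variable {Mh k R : ℕ} {P' : Fin (d + 1) → ℕ}
variable (hN : ∀ μ, N0 ℓ Mh k P' μ = (PV d ℓ m K hd hL).sitesPerDir 0) (D : TDomains d ℓ Mh k P' R) (hk : k ≤ m + K)

/-- every row entry of a bump is `≤ L^{−jD}·Στ·(Στ_⊥)^d` (rows of level `< j` vanish). [cite: Balaban1984PropagatorsII, (2.147) p.248, bookkeeping] -/
theorem pair_le' (hRM : 2 ≤ R * Mh) (i i' : BondIdx (domT hN D hk)) :
    QE (domT hN D hk) (bump hN D hk i) i' ≤ ((((ℓ + 1 : ℕ) : ℝ) ^ (d + 1)) ^ (lvl hN D hk i))⁻¹ * (tsumL hN D hk i * Tsum (ℓ := ℓ) (lvl hN D hk i) ^ d) := by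
  by_cases h0 : QE (domT hN D hk) (bump hN D hk i) i' = 0
  · rw [h0]
    exact mul_nonneg (by positivity) (mul_nonneg (Finset.sum_nonneg fun t _ => tauL_nonneg hN D hk i t) (pow_nonneg (Tsum_pos (ℓ := ℓ) _).le _))
  · have hw := level_window hN D hk hRM i i' h0
    refine ((le_abs_self _).trans (pair_le hN D hk i i')).trans (mul_le_mul_of_nonneg_right ?_ ?_)
    · refine inv_anti₀ (by positivity) (pow_le_pow_right₀ ?_ hw.1)
      have hL1 : (1 : ℝ) ≤ ((ℓ + 1 : ℕ) : ℝ) := by exact_mod_cast Nat.succ_le_succ (Nat.zero_le ℓ)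
      exact one_le_pow₀ hL1
    · exact mul_nonneg (Finset.sum_nonneg fun t _ => tauL_nonneg hN D hk i t) (pow_nonneg (Tsum_pos (ℓ := ℓ) _).le _)

/-- **THE `Q`-PART OF THE ENERGY OF ONE BUMP**: with the upper band `w_{i′} ≤ b₁c_f²L^{j′D}/L^{2j′}` ((2.16)),
`Σ_{i′} w_{i′}(Qφ_i)_{i′}² ≤ 2b₁c_f²L^D·L^{−2j}·L^{−jD}·(Στ(Στ_⊥)^d)²`. [cite: Balaban1984PropagatorsII, (2.16) p.225, (2.147) p.248] -/
theorem qenergy_bump_le (hRM : 2 ≤ R * Mh) (hper : ∀ n, n ≤ k + 1 → 2 ≤ (PV d ℓ m K hd hL).sitesPerDir n)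
    {cf b₁ : ℝ} (hb₁ : 0 ≤ b₁) {w : BondIdx (domT hN D hk) → ℝ}
    (hwup : ∀ i', w i' ≤ b₁ * cf ^ 2 * (((ℓ + 1 : ℕ) : ℝ) ^ (d + 1)) ^ (lvl hN D hk i') / ((((ℓ + 1 : ℕ) : ℝ)) ^ (lvl hN D hk i')) ^ 2)
    (i : BondIdx (domT hN D hk)) :
    ∑ i', w i' * QE (domT hN D hk) (bump hN D hk i) i' ^ 2 ≤
      2 * b₁ * cf ^ 2 * (((ℓ + 1 : ℕ) : ℝ)) ^ (d + 1) * (((((ℓ + 1 : ℕ) : ℝ)) ^ (lvl hN D hk i)) ^ 2)⁻¹ *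
        ((((ℓ + 1 : ℕ) : ℝ) ^ (d + 1)) ^ (lvl hN D hk i))⁻¹ * (tsumL hN D hk i * Tsum (ℓ := ℓ) (lvl hN D hk i) ^ d) ^ 2 := by
  set j := lvl hN D hk i
  set Lr : ℝ := ((ℓ + 1 : ℕ) : ℝ) with hLr
  set M := tsumL hN D hk i * Tsum (ℓ := ℓ) j ^ d with hM
  have hL1 : 1 ≤ Lr := by rw [hLr]; exact_mod_cast Nat.succ_le_succ (Nat.zero_le ℓ)
  have hL0 : 0 < Lr := lt_of_lt_of_le zero_lt_one hL1
  have hM0 : 0 ≤ M := mul_nonneg (Finset.sum_nonneg fun t _ => tauL_nonneg hN D hk i t) (pow_nonneg (Tsum_pos (ℓ := ℓ) _).le _)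
  set wmax : ℝ := b₁ * cf ^ 2 * Lr ^ (d + 1) * (Lr ^ (d + 1)) ^ j / (Lr ^ j) ^ 2 with hwmax
  set cmax : ℝ := ((Lr ^ (d + 1)) ^ j)⁻¹ * M with hcmax
  have hwmax0 : 0 ≤ wmax := by positivity
  have hcmax0 : 0 ≤ cmax := by positivity
  -- termwise: `w c² ≤ wmax·cmax·c`
  have hterm : ∀ i', w i' * QE (domT hN D hk) (bump hN D hk i) i' ^ 2 ≤ wmax * cmax * QE (domT hN D hk) (bump hN D hk i) i' := by
    intro i'
    by_cases h0 : QE (domT hN D hk) (bump hN D hk i) i' = 0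
    · rw [h0]; simp
    · have hc0 := pair_nonneg hN D hk i i'
      have hwin := level_window hN D hk hRM i i' h0
      have hc : QE (domT hN D hk) (bump hN D hk i) i' ≤ cmax := pair_le' hN D hk hRM i i'
      -- the weight bound at levels `j`, `j+1`
      have hwle : w i' ≤ wmax := by
        refine (hwup i').trans ?_
        rw [hwmax]
        have hj' : lvl hN D hk i' = j ∨ lvl hN D hk i' = j + 1 := by omega
        rw [div_le_div_iff₀ (by positivity) (by positivity)]
        rcases hj' with h | h
        · rw [h]
          have h1 : (1 : ℝ) ≤ Lr ^ (d + 1) := one_le_pow₀ hL1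
          have h2 : 0 ≤ b₁ * cf ^ 2 * (Lr ^ (d + 1)) ^ j * (Lr ^ j) ^ 2 := by positivity
          calc b₁ * cf ^ 2 * (Lr ^ (d + 1)) ^ j * (Lr ^ j) ^ 2 = 1 * (b₁ * cf ^ 2 * (Lr ^ (d + 1)) ^ j * (Lr ^ j) ^ 2) := by ring
            _ ≤ Lr ^ (d + 1) * (b₁ * cf ^ 2 * (Lr ^ (d + 1)) ^ j * (Lr ^ j) ^ 2) := mul_le_mul_of_nonneg_right h1 h2
            _ = _ := by ring
        · rw [h]
          have key : (Lr ^ j) ^ 2 ≤ (Lr ^ (j + 1)) ^ 2 := pow_le_pow_left₀ (by positivity) (pow_le_pow_right₀ hL1 (Nat.le_succ j)) 2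
          have h2 : 0 ≤ b₁ * cf ^ 2 * Lr ^ (d + 1) * (Lr ^ (d + 1)) ^ j := by positivity
          calc b₁ * cf ^ 2 * (Lr ^ (d + 1)) ^ (j + 1) * (Lr ^ j) ^ 2 = (b₁ * cf ^ 2 * Lr ^ (d + 1) * (Lr ^ (d + 1)) ^ j) * (Lr ^ j) ^ 2 := by ring
            _ ≤ (b₁ * cf ^ 2 * Lr ^ (d + 1) * (Lr ^ (d + 1)) ^ j) * (Lr ^ (j + 1)) ^ 2 := mul_le_mul_of_nonneg_left key h2
            _ = _ := by ring
      by_cases hw0 : 0 ≤ w i'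
      · calc w i' * QE (domT hN D hk) (bump hN D hk i) i' ^ 2 = (w i' * QE (domT hN D hk) (bump hN D hk i) i') * QE (domT hN D hk) (bump hN D hk i) i' := by ring
          _ ≤ (wmax * cmax) * QE (domT hN D hk) (bump hN D hk i) i' := by
              refine mul_le_mul_of_nonneg_right ?_ hc0
              exact mul_le_mul hwle hc hc0 hwmax0
          _ = _ := by ring
      · have h1 : w i' * QE (domT hN D hk) (bump hN D hk i) i' ^ 2 ≤ 0 := mul_nonpos_of_nonpos_of_nonneg (le_of_not_ge hw0) (sq_nonneg _)
        exact h1.trans (mul_nonneg (mul_nonneg hwmax0 hcmax0) hc0)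
  refine (Finset.sum_le_sum fun i' _ => hterm i').trans ?_
  rw [← Finset.mul_sum]
  have hsum := sum_pair_le hN D hk hRM hper i
  calc wmax * cmax * ∑ i', QE (domT hN D hk) (bump hN D hk i) i' ≤ wmax * cmax * (2 * ((Lr ^ (d + 1)) ^ j)⁻¹ * M) :=
        mul_le_mul_of_nonneg_left hsum (mul_nonneg hwmax0 hcmax0)
    _ = _ := by
        rw [hwmax, hcmax]
        field_simp

end QEnergy2

/-! ## §5c  The coarse rows: each fine bump is seen by ≤ 2 rows of level `j + 1`; each such row sees ≤ 2L^D fine bumps -/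

section Coarse

open B5Eq118OneStroke (iterBlock iterBlockOf mem_iterBlock card_iterBlock)
open B6MultiLevelBoxOperator (N0)
open B6MultiLevelTorusOperatorL0 (TDomains)
open B6GlobalChartV1 (PV toBox)
open B6GlobalChartV1L0 (domT)
open B6Ineq2142KLevelV1 (cQ iterBlockOf_runSite_mem iterBlockOf_eq_of_le shift_injective)
open B6Ineq2142KLevelV1L0 (lvl lvl_le lvl_le_mK base other ends_eq baseSite iterBlockOf_baseSite lev_eq_of_base qwt exists_of_qwt_ne_zero)

variable {d ℓ m K : ℕ} {hd : 1 ≤ d + 1} {hL : Odd (ℓ + 1) ∧ 1 < ℓ + 1}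
variable {Mh k R : ℕ} {P' : Fin (d + 1) → ℕ}
variable (hN : ∀ μ, N0 ℓ Mh k P' μ = (PV d ℓ m K hd hL).sitesPerDir 0) (D : TDomains d ℓ Mh k P' R) (hk : k ≤ m + K)

/-- **A NONZERO ROW GIVES A WITNESS BOND**: `f₋` in the base block of `i`, in the double block of `i′`, same direction.
[cite: Balaban1984PropagatorsII, (2.147) p.248, bookkeeping] -/
theorem witness_of_pair_ne_zero (i i' : BondIdx (domT hN D hk)) (h : QE (domT hN D hk) (bump hN D hk i) i' ≠ 0) :
    i'.1.2.dir = i.1.2.dir ∧ ∃ z : Site (PV d ℓ m K hd hL) 0, iterBlockOf (lvl hN D hk i) z = base hN D hk i ∧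
      (iterBlockOf (lvl hN D hk i') z = i'.1.2.src ∨ iterBlockOf (lvl hN D hk i') z = i'.1.2.tgt) := by
  classical
  have hdir : i'.1.2.dir = i.1.2.dir := by
    by_contra hne; exact h (pair_eq_zero_of_dir_ne hN D hk i i' hne)
  rw [QE_apply_eq_sum_qwt] at h
  obtain ⟨f, -, hf⟩ := Finset.exists_ne_zero_of_sum_ne_zero h
  have hq : qwt hN D hk i' f ≠ 0 := left_ne_zero_of_mul hf
  have hb : bump hN D hk i f ≠ 0 := right_ne_zero_of_mul hf
  have hsrc := (bump_ne_zero_imp hN D hk i hb).2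
  rw [mem_iterBlock] at hsrc
  obtain ⟨x, hx, t, ht, hxt⟩ := exists_of_qwt_ne_zero hN D hk i' hq
  rw [mem_iterBlock] at hx
  have hs : f.src = runSite x i'.1.2.dir t := by rw [← hxt]; rfl
  refine ⟨hdir, f.src, hsrc, ?_⟩
  rcases iterBlockOf_runSite_mem (lvl_le_mK hN D hk i') x i'.1.2.dir ht.le with h' | h'
  · left; rw [hs, h', hx]
  · right; rw [hs, h', hx]; rfl

/-- **AT MOST TWO ROWS OF LEVEL `j+1` SEE THE BUMP `φ_i`** (their source block is the `(j+1)`-block over the base block of `i` or its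
`μ`-predecessor). [cite: Balaban1984PropagatorsII, (2.147) p.248, (2.1)–(2.3) p.224, bookkeeping] -/
theorem card_coarse_rows_le (i : BondIdx (domT hN D hk)) :
    (Finset.univ.filter fun i' : BondIdx (domT hN D hk) => lvl hN D hk i' = lvl hN D hk i + 1 ∧ QE (domT hN D hk) (bump hN D hk i) i' ≠ 0).card ≤ 2 := by
  classical
  set j := lvl hN D hk i
  set μ := i.1.2.dir
  set x₀ := baseSite hN D hk i
  set K1 := iterBlock (j + 1) (iterBlockOf (j + 1) x₀)
  set K2 := iterBlock (j + 1) ((iterBlockOf (j + 1) x₀).unshift μ)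
  have hsub : (Finset.univ.filter fun i' : BondIdx (domT hN D hk) => lvl hN D hk i' = j + 1 ∧ QE (domT hN D hk) (bump hN D hk i) i' ≠ 0) ⊆
      (Finset.univ.filter fun i' : BondIdx (domT hN D hk) => lvl hN D hk i' = j + 1 ∧ i'.1.2.dir = μ ∧ srcBlk hN D hk i' = K1) ∪
      (Finset.univ.filter fun i' : BondIdx (domT hN D hk) => lvl hN D hk i' = j + 1 ∧ i'.1.2.dir = μ ∧ srcBlk hN D hk i' = K2) := by
    intro i' hi'
    rw [Finset.mem_filter] at hi'
    obtain ⟨-, hj', hne⟩ := hi'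
    obtain ⟨hdir, z, hz, hends⟩ := witness_of_pair_ne_zero hN D hk i i' hne
    -- the `(j+1)`-block of `z` is that of `x₀`
    have hle : lvl hN D hk i ≤ lvl hN D hk i' := by rw [hj']; exact Nat.le_succ j
    have hzx : iterBlockOf (lvl hN D hk i') z = iterBlockOf (lvl hN D hk i') x₀ :=
      iterBlockOf_eq_of_le (n := lvl hN D hk i) (n' := lvl hN D hk i') hle (by rw [hz, iterBlockOf_baseSite])
    rw [Finset.mem_union, Finset.mem_filter, Finset.mem_filter]
    rcases hends with h | h
    · left
      refine ⟨Finset.mem_univ _, hj', hdir, ?_⟩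
      show iterBlock (lvl hN D hk i') i'.1.2.src = (fun n => iterBlock n (iterBlockOf n x₀)) (j + 1)
      rw [← hj']
      show iterBlock (lvl hN D hk i') i'.1.2.src = iterBlock (lvl hN D hk i') (iterBlockOf (lvl hN D hk i') x₀)
      rw [← hzx, h]
    · right
      refine ⟨Finset.mem_univ _, hj', hdir, ?_⟩
      have hsrc : i'.1.2.src = (iterBlockOf (lvl hN D hk i') z).unshift i'.1.2.dir := (tgt_eq_iff_src_eq i'.1.2 _).1 h.symm
      show iterBlock (lvl hN D hk i') i'.1.2.src = (fun n => iterBlock n ((iterBlockOf n x₀).unshift μ)) (j + 1)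
      rw [← hj']
      show iterBlock (lvl hN D hk i') i'.1.2.src = iterBlock (lvl hN D hk i') ((iterBlockOf (lvl hN D hk i') x₀).unshift μ)
      rw [hsrc, hzx, hdir]
  refine (Finset.card_le_card hsub).trans ((Finset.card_union_le _ _).trans ?_)
  have h1 := card_key_le_one hN D hk (j + 1) μ K1
  have h2 := card_key_le_one hN D hk (j + 1) μ K2
  omega

/-- **A FINE BUMP SEEN BY A COARSE ROW LIES IN THE NON-BASE END BLOCK OF THAT ROW**: `B^j(base i) ⊆ B^{j+1}(other i′)` (the base end of
`i′` has level `j+1` sites, the base block of `i` has level `j` sites). [cite: Balaban1984PropagatorsII, (2.1)–(2.3) p.224, (2.45) p.231] -/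
theorem baseBlk_subset_other (i i' : BondIdx (domT hN D hk)) (hj : lvl hN D hk i' = lvl hN D hk i + 1)
    (h : QE (domT hN D hk) (bump hN D hk i) i' ≠ 0) :
    iterBlock (lvl hN D hk i) (base hN D hk i) ⊆ iterBlock (lvl hN D hk i') (other hN D hk i') := by
  obtain ⟨-, z, hz, hends⟩ := witness_of_pair_ne_zero hN D hk i i' h
  -- `z` is not under the base end of `i′`
  have hnot : iterBlockOf (lvl hN D hk i') z ≠ base hN D hk i' := by
    intro hb
    have h1 := lev_eq_of_base hN D hk i hz
    have h2 := lev_eq_of_base hN D hk i' hb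
    omega
  have hoth : iterBlockOf (lvl hN D hk i') z = other hN D hk i' := by
    rcases ends_eq hN D hk i' with ⟨hb, ho⟩ | ⟨hb, ho⟩
    · rw [ho]; rcases hends with h' | h'
      · exact absurd (h'.trans hb.symm) hnot
      · exact h'
    · rw [ho]; rcases hends with h' | h'
      · exact h'
      · exact absurd (h'.trans hb.symm) hnot
  intro x hx
  rw [mem_iterBlock] at hx ⊢
  rw [← hoth]
  exact iterBlockOf_eq_of_le (by rw [hj]; exact Nat.le_succ _) (hx.trans hz.symm)

/-- **AT MOST `2L^D` FINE BUMPS OF DIRECTION `μ` ARE SEEN BY ONE COARSE ROW** (their base blocks are disjoint `j`-blocks of the non-base end,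
`L^D` of them, two bumps per block). [cite: Balaban1984PropagatorsII, (2.147) p.248, (2.1)–(2.3) p.224, bookkeeping] -/
theorem card_fine_seen_le (i' : BondIdx (domT hN D hk)) :
    (Finset.univ.filter fun i : BondIdx (domT hN D hk) => lvl hN D hk i' = lvl hN D hk i + 1 ∧ QE (domT hN D hk) (bump hN D hk i) i' ≠ 0).card ≤
      2 * (ℓ + 1) ^ (d + 1) := by
  classical
  -- LEVEL-0 TWIN (joint J7): the lineage's guard `1 ≤ j(i′) − 1` is dropped; a level-0 row sees no finer bump at all
  rcases Nat.eq_zero_or_pos (lvl hN D hk i') with hj0 | hj1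
  · refine le_trans (le_of_eq (Finset.card_eq_zero.2 (Finset.filter_eq_empty_iff.2 fun i _ h => ?_))) (Nat.zero_le _)
    have := h.1; omega
  set j' := lvl hN D hk i'
  set j := j' - 1 with hjdef
  set μ := i'.1.2.dir
  set T := iterBlock j' (other hN D hk i')
  have hj'm : j' ≤ m + K := lvl_le_mK hN D hk i'
  have hjm : j ≤ m + K := by omega
  -- the two families (case A: source block ⊆ T; case B: target block ⊆ T), keyed by their source block
  set FA := Finset.univ.filter fun i : BondIdx (domT hN D hk) => lvl hN D hk i = j ∧ i.1.2.dir = μ ∧ srcBlk hN D hk i ⊆ T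
  set FB := Finset.univ.filter fun i : BondIdx (domT hN D hk) => lvl hN D hk i = j ∧ i.1.2.dir = μ ∧ iterBlock (lvl hN D hk i) i.1.2.tgt ⊆ T
  have hsub : (Finset.univ.filter fun i : BondIdx (domT hN D hk) => lvl hN D hk i' = lvl hN D hk i + 1 ∧ QE (domT hN D hk) (bump hN D hk i) i' ≠ 0) ⊆ FA ∪ FB := by
    intro i hi
    rw [Finset.mem_filter] at hi
    obtain ⟨-, hji, hne⟩ := hi
    have hlv : lvl hN D hk i = j := by omega
    have hdir := (witness_of_pair_ne_zero hN D hk i i' hne).1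
    have hsubT := baseBlk_subset_other hN D hk i i' hji hne
    rw [Finset.mem_union, Finset.mem_filter, Finset.mem_filter]
    by_cases hA : i.1.2.src ∈ (domT hN D hk).Om (lvl hN D hk i)
    · left; refine ⟨Finset.mem_univ _, hlv, hdir.symm, ?_⟩
      unfold srcBlk; rwa [base_eq_src_of hN D hk i hA] at hsubT
    · right; refine ⟨Finset.mem_univ _, hlv, hdir.symm, ?_⟩
      rwa [base_eq_tgt_of hN D hk i hA] at hsubT
  -- disjoint-blocks counting inside `T`
  have hT : T.card = ((ℓ + 1) ^ (d + 1)) ^ j' := card_iterBlock _ hj'm _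
  have hpow : ((ℓ + 1) ^ (d + 1)) ^ j' = ((ℓ + 1) ^ (d + 1)) ^ j * (ℓ + 1) ^ (d + 1) := by
    rw [← pow_succ]; congr 1; omega
  have count : ∀ (F : Finset (BondIdx (domT hN D hk))) (blk : BondIdx (domT hN D hk) → Finset (Site (PV d ℓ m K hd hL) 0)),
      (∀ i ∈ F, blk i ⊆ T) → (∀ i ∈ F, (blk i).card = ((ℓ + 1) ^ (d + 1)) ^ j) →
      (∀ i ∈ F, ∀ i₂ ∈ F, i ≠ i₂ → Disjoint (blk i) (blk i₂)) → F.card ≤ (ℓ + 1) ^ (d + 1) := by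
    intro F blk hsubF hcard hdisj
    have h1 : (F.biUnion blk).card = F.card * ((ℓ + 1) ^ (d + 1)) ^ j := by
      rw [Finset.card_biUnion hdisj, Finset.sum_congr rfl hcard, Finset.sum_const, smul_eq_mul]
    have h2 : (F.biUnion blk).card ≤ T.card := Finset.card_le_card (Finset.biUnion_subset.2 hsubF)
    rw [h1, hT, hpow] at h2
    have h3 : F.card * ((ℓ + 1) ^ (d + 1)) ^ j ≤ (ℓ + 1) ^ (d + 1) * ((ℓ + 1) ^ (d + 1)) ^ j := by rw [mul_comm ((ℓ + 1) ^ (d + 1))]; exact h2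
    exact Nat.le_of_mul_le_mul_right h3 (by positivity)
  have hA : FA.card ≤ (ℓ + 1) ^ (d + 1) := by
    refine count FA (srcBlk hN D hk) (fun i hi => (Finset.mem_filter.1 hi).2.2.2) (fun i hi => ?_) (fun i hi i₂ hi₂ hne => ?_)
    · have hlv := (Finset.mem_filter.1 hi).2.1
      unfold srcBlk; rw [card_iterBlock _ (lvl_le_mK hN D hk i), hlv]
    · have h1 := Finset.mem_filter.1 hi
      have h2 := Finset.mem_filter.1 hi₂
      rw [Finset.disjoint_left]
      intro x hx hx2
      apply hne
      refine ext_of_key hN D hk (h1.2.1.trans h2.2.1.symm) (h1.2.2.1.trans h2.2.2.1.symm) ?_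
      -- two blocks of the same level sharing a site coincide
      unfold srcBlk at hx hx2 ⊢
      rw [mem_iterBlock] at hx hx2
      obtain ⟨⟨j₁, b₁⟩, hb₁⟩ := i
      obtain ⟨⟨j₂, b₂⟩, hb₂⟩ := i₂
      have hjj : j₁ = j₂ := Fin.ext (by have := h1.2.1.trans h2.2.1.symm; simpa [lvl] using this)
      subst hjj
      simp only [lvl] at hx hx2 ⊢
      rw [← hx, ← hx2]
  have hB : FB.card ≤ (ℓ + 1) ^ (d + 1) := by
    refine count FB (fun i => iterBlock (lvl hN D hk i) i.1.2.tgt) (fun i hi => (Finset.mem_filter.1 hi).2.2.2) (fun i hi => ?_) (fun i hi i₂ hi₂ hne => ?_)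
    · have hlv := (Finset.mem_filter.1 hi).2.1
      show (iterBlock (lvl hN D hk i) i.1.2.tgt).card = _
      rw [card_iterBlock _ (lvl_le_mK hN D hk i), hlv]
    · have h1 := Finset.mem_filter.1 hi
      have h2 := Finset.mem_filter.1 hi₂
      rw [Finset.disjoint_left]
      intro x hx hx2
      apply hne
      refine ext_of_key hN D hk (h1.2.1.trans h2.2.1.symm) (h1.2.2.1.trans h2.2.2.1.symm) ?_
      unfold srcBlk
      change x ∈ iterBlock (lvl hN D hk i) i.1.2.tgt at hx
      change x ∈ iterBlock (lvl hN D hk i₂) i₂.1.2.tgt at hx2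
      rw [mem_iterBlock] at hx hx2
      obtain ⟨⟨j₁, b₁⟩, hb₁⟩ := i
      obtain ⟨⟨j₂, b₂⟩, hb₂⟩ := i₂
      have hjj : j₁ = j₂ := Fin.ext (by have := h1.2.1.trans h2.2.1.symm; simpa [lvl] using this)
      subst hjj
      simp only [lvl] at hx hx2 h1 h2 ⊢
      have htgt : b₁.tgt = b₂.tgt := hx.symm.trans hx2
      have hdir : b₁.dir = b₂.dir := h1.2.2.1.trans h2.2.2.1.symm
      unfold PBond.tgt at htgt
      rw [hdir] at htgt
      rw [shift_injective b₂.dir htgt]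
  calc _ ≤ (FA ∪ FB).card := Finset.card_le_card hsub
    _ ≤ FA.card + FB.card := Finset.card_union_le _ _
    _ ≤ (ℓ + 1) ^ (d + 1) + (ℓ + 1) ^ (d + 1) := Nat.add_le_add hA hB
    _ = 2 * (ℓ + 1) ^ (d + 1) := by ring

end Coarse

end

end Literature.MathematicalPhysics.QuantumFieldTheory.Balaban1983to89.B6QGQTestBumpsKLevelV1L0
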